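import Mathlib.MeasureTheory.Integral.IntervalIntegral.AbsolutelyContinuousFun
import Literature.Analysis.FluidPDE.KNSSSwirlTransport
import Literature.Analysis.FluidPDE.CylindricalIntegration
import Literature.Analysis.FluidPDE.SwirlCutoff
import Literature.Analysis.FluidPDE.AxisymWeights
import HarnessLib

/-!
# KNSS 2009, Theorem 5.3: the Liouville statement for the swirl from Lemma 2.1

Koch–Nadirashvili–Seregin–Šverák, *Liouville theorems for the Navier–Stokes equations and
applications*, Acta Math. 203 (2009) 83–105 (= arXiv:0709.3599), proof of Theorem 5.3
(arXiv p. 10, (5.10)–(5.20)).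

The companion file `KNSSSwirlLiouville` reduces Theorem 5.3 (`KNSS2009_liouville_bound_C_over_r`,
file `KNSSLiouville`) to three printed inputs (`KNSS2009_liouville_bound_C_over_r_of_facts`):
the §4 regularity / swirl-equation fact `KNSS2009_regularity_axisymmetric_swirl`, Theorem 5.2
`KNSS2009_liouville_axisymmetric_no_swirl`, and the Liouville-type statement
`KNSS2009_swirl_sup_nonpos` for bounded ancient solutions `f = r u_θ` of the swirl equation
(5.10) `fₜ + u·∇f = Δf − (2/r) ∂ᵣ f` with `|u| ≤ C/r`, `f = 0` on the axis: `sup f ≤ 0`.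

This file **proves** `KNSS2009_swirl_sup_nonpos` from Lemma 2.1 (`KNSS2009_lemma21`, the
stability form of the strong maximum principle, vendored as printed in `KNSSSwirlLiouville`),
following the printed argument on p. 10 line by line:

1. `M := sup f > 0` is approached at points off the axis (`IsKNSSSwirlPair.exists_sup`);
2. **Lemma 2.1 + scaling** (`IsKNSSSwirlPair.exists_rescale_ge`): rescaling by
   `λ = r(x̄)/(3/2)` about a near-maximum point and applying Lemma 2.1 on the annular cylinder
   `Ω = {1/2 < r < 3, |z| < L + 1}` with `K = {1 ≤ r ≤ 2, |z| ≤ L}`, `τ = 1`, to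
   `g = f_λ − M ≤ 0` (drift `λu_λ + (2/r) e_r`, bounded by `2C_u + 4` on `Ω`), the rescaled
   solution (`IsKNSSSwirlPair.rescale`, file `KNSSSwirlTransport`) is `≥ M − ε` on
   `K × (1, T)` — for *every* `L, T` and `ε > 0`;
3. **the test-function identity** ((5.15)–(5.20)): with `φ(y, s) = ξ(r) η_L(z) ζ_T(s)`
   (file `SwirlCutoff`), the swirl equation integrated against `φ` gives
   `∫∫ (F − M) ∂ₛφ + ∫∫ (F − M)(u·∇φ + Δφ) + ∫∫ (2/r) F ∂ᵣφ = 0`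
   (`IsKNSSSwirlPair.spaceTime_identity`; the printed `δ`-regularisation (5.16)–(5.18) near the
   axis is unnecessary because `F = 0` on the axis makes `(2/r) F ∂ᵣφ` integrable, file
   `CylindricalIntegration`), via the slice identity (Green, `div u = 0`, and the axis
   integration by parts `∫ (2/r) ∂ᵣF φ = −∫ (2/r) F ∂ᵣφ`) and a time integration by parts;
4. **the three estimates** (`estimate_I/II/III`): the `∂ₛφ` and transport terms are
   `O(L) + O(1) + O(ε · C(L, T))` ("controlled by `C₂ M (L + T)`", the near-axis part lives on
   the band `L − 1 ≤ |z| ≤ L` and is integrable since `|u| ≤ C/r`), while the axis term is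
   `≤ −4 c₂ (M − ε)(L − 1) ∫ζ ≤ −c M (L − 1)(T − 3)` ("`−C₁ M² T L` with `C₁ > 0`");
5. choosing `L = T = n` large and then `ε` small gives the contradiction
   (`KNSS2009_swirl_sup_nonpos_of_lemma21`).

Consequently Theorem 5.3 rests on the printed Lemma 2.1, §4 and Theorem 5.2 only
(`KNSS2009_liouville_bound_C_over_r_of_lemma21`).

## Main results

* `KNSS2009_swirl_sup_nonpos_of_lemma21 : KNSS2009_lemma21 (E³) → KNSS2009_swirl_sup_nonpos`.
* `KNSS2009_liouville_bound_C_over_r_of_lemma21`: Theorem 5.3 from Lemma 2.1, §4, Thm 5.2.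
* `IsKNSSSwirlPair.exists_rescale_ge`, `IsKNSSSwirlPair.spaceTime_identity`,
  `IsKNSSSwirlPair.estimate_I`, `.estimate_II`, `.estimate_III`: steps 2–4 above.
* `annCyl`, `annCylClosed` (annular cylinders, `isConnected_annCyl`), `etaBand`,
  `swirlEqnIntegrand`: auxiliary notions.

## References

* [KochNadirashviliSereginSverak2009] G. Koch, N. Nadirashvili, G. Seregin, V. Šverák,
  Liouville theorems for the Navier–Stokes equations and applications, Acta Math. 203 (2009),
  83–105; arXiv:0709.3599 — §2 Lemma 2.1 (p. 5), §5 Theorem 5.3 and its proof (pp. 9–10).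
-/

noncomputable section

open MeasureTheory Set Function Filter Topology TopologicalSpace InnerProductSpace WithLp Metric
open scoped Laplacian RealInnerProductSpace ContDiff

namespace Literature.Analysis.FluidPDE

/-- Local notation for physical space `ℝ³ = EuclideanSpace ℝ (Fin 3)`. -/
local notation "ℝ³" => EuclideanSpace ℝ (Fin 3)


/-! ### Time integration by parts against a function given by an integral -/

section TimeIBP

/-- **Integration by parts in time for a function given as an integral.** If on `[a, b]`
`Φ(s) = Φ(a) + ∫ₐˢ g` with `g` integrable, and `ψ ∈ C¹` vanishes at `a` and `b`, then
`∫ₐᵇ (Φ − M) ψ' = −∫ₐᵇ g ψ` (the time integration by parts `∫ fₜ φ = −∫ (f − M) φₜ` of KNSS 2009,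
(5.17), for the time-integrated swirl equation; Mathlib's integration by parts for absolutely
continuous functions and the Lebesgue differentiation theorem). [cite: KochNadirashviliSereginSverak2009, proof of Thm 5.3, (5.17) (arXiv p. 10)] -/
theorem integral_sub_const_mul_deriv_eq_neg {Φ g ψ : ℝ → ℝ} {a b : ℝ} (hab : a ≤ b)
    (hg : IntervalIntegrable g volume a b) (hΦ : ∀ s ∈ Icc a b, Φ s = Φ a + ∫ r in a..s, g r)
    (hψ : ContDiff ℝ 1 ψ) (hψa : ψ a = 0) (hψb : ψ b = 0) (M : ℝ) :
    ∫ s in a..b, (Φ s - M) * deriv ψ s = -∫ s in a..b, g s * ψ s := by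
  set P : ℝ → ℝ := fun s => ∫ r in a..s, g r with hP
  have hPac : AbsolutelyContinuousOnInterval P a b :=
    hg.absolutelyContinuousOnInterval_intervalIntegral (by simp [hab])
  have hψac : AbsolutelyContinuousOnInterval ψ a b := (hψ.contDiffOn).absolutelyContinuousOnInterval
  have hψd : ∀ s, HasDerivAt ψ (deriv ψ s) s := fun s =>
    ((hψ.differentiable one_ne_zero) s).hasDerivAt
  -- split `Φ − M = (Φ a − M) + P` on `[a, b]`
  have hi1 : IntervalIntegrable (fun s => (Φ a - M) * deriv ψ s) volume a b :=
    ((hψ.continuous_deriv le_rfl).intervalIntegrable _ _).const_mul _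
  have hi2 : IntervalIntegrable (fun s => P s * deriv ψ s) volume a b :=
    (hPac.continuousOn.mul (hψ.continuous_deriv le_rfl).continuousOn).intervalIntegrable
  have h1 : ∫ s in a..b, (Φ s - M) * deriv ψ s =
      (Φ a - M) * (∫ s in a..b, deriv ψ s) + ∫ s in a..b, P s * deriv ψ s := by
    rw [← intervalIntegral.integral_const_mul, ← intervalIntegral.integral_add hi1 hi2]
    refine intervalIntegral.integral_congr fun s hs => ?_
    rw [uIcc_of_le hab] at hs
    simp only [hP]
    rw [hΦ s hs]; ring
  -- `∫ ψ' = ψ b − ψ a = 0`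
  have h2 : ∫ s in a..b, deriv ψ s = 0 := by
    rw [intervalIntegral.integral_eq_sub_of_hasDerivAt (fun s _ => hψd s)
      ((hψ.continuous_deriv le_rfl).intervalIntegrable _ _), hψa, hψb, sub_zero]
  -- integration by parts for the absolutely continuous `P`
  have h3 : ∫ s in a..b, P s * deriv ψ s = -∫ s in a..b, deriv P s * ψ s := by
    rw [hPac.integral_mul_deriv_eq_deriv_mul hψac, hψa, hψb]
    simp [hP]
  -- `P' = g` a.e.
  have h4 : ∫ s in a..b, deriv P s * ψ s = ∫ s in a..b, g s * ψ s := by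
    refine intervalIntegral.integral_congr_ae ?_
    filter_upwards [hg.ae_hasDerivAt_integral] with s hs hsmem
    have hs' : s ∈ uIcc a b := uIoc_subset_uIcc hsmem
    rw [(hs hs' a (by simp)).deriv]
  rw [h1, h2, mul_zero, zero_add, h3, h4]

end TimeIBP

/-! ### The supremum of `f` and near-maximum points off the axis -/

section Sup

variable {Cf Cu : ℝ} {f : ℝ → ℝ³ → ℝ} {u : ℝ → ℝ³ → ℝ³}

/-- The supremum `M = sup {f(t, x) : t < 0}` of the scalar of a swirl pair exists (it is bounded
by `C_f`), dominates `f`, and is approached; if `f` takes a positive value, `M > 0` and the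
near-maximum points `f > M − η`, `η ≤ M/2`, are off the axis (where `f = 0`) (KNSS 2009, p. 10:
"Let `M = sup f` … assume that `M > 0` … we can move points where `f^λ` is almost equal to `M`
close to the `x₃`-axis"). [cite: KochNadirashviliSereginSverak2009, proof of Thm 5.3 (arXiv p. 10)] -/
theorem IsKNSSSwirlPair.exists_sup (h : IsKNSSSwirlPair Cf Cu 0 f u) {t₀ : ℝ} (ht₀ : t₀ < 0)
    {x₀ : ℝ³} (hpos : 0 < f t₀ x₀) :
    ∃ M : ℝ, 0 < M ∧ M ≤ Cf ∧ (∀ t < 0, ∀ x, f t x ≤ M) ∧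
      ∀ η > 0, ∃ t < 0, ∃ x, M - η < f t x ∧ (η ≤ M → cylRadius x ≠ 0) := by
  set S : Set ℝ := {v | ∃ t < 0, ∃ x, f t x = v} with hS
  have hbdd : BddAbove S := ⟨Cf, by rintro v ⟨t, ht, x, rfl⟩; exact (le_abs_self _).trans (h.abs_le t ht x)⟩
  have hne : S.Nonempty := ⟨f t₀ x₀, t₀, ht₀, x₀, rfl⟩
  refine ⟨sSup S, ?_, ?_, ?_, ?_⟩
  · exact lt_of_lt_of_le hpos (le_csSup hbdd ⟨t₀, ht₀, x₀, rfl⟩)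
  · exact csSup_le hne (by rintro v ⟨t, ht, x, rfl⟩; exact (le_abs_self _).trans (h.abs_le t ht x))
  · intro t ht x
    exact le_csSup hbdd ⟨t, ht, x, rfl⟩
  · intro η hη
    obtain ⟨v, ⟨t, ht, x, rfl⟩, hv⟩ := exists_lt_of_lt_csSup hne (by linarith : sSup S - η < sSup S)
    refine ⟨t, ht, x, hv, fun hηM hx => ?_⟩
    have h0 := h.axis t ht x hx
    have hM : 0 < sSup S := lt_of_lt_of_le hpos (le_csSup hbdd ⟨t₀, ht₀, x₀, rfl⟩)
    linarith

end Sup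

/-! ### The annular cylinders of the Lemma 2.1 step -/

section Geometry

/-- The open annular cylinder `{a < r < b, |z| < c}`. [folklore] -/
def annCyl (a b c : ℝ) : Set ℝ³ := {y | a < cylRadius y ∧ cylRadius y < b ∧ |y 2| < c}

/-- The closed annular cylinder `{a ≤ r ≤ b, |z| ≤ c}`. [folklore] -/
def annCylClosed (a b c : ℝ) : Set ℝ³ := {y | a ≤ cylRadius y ∧ cylRadius y ≤ b ∧ |y 2| ≤ c}

/-- Open annular cylinders are open. [folklore] -/
theorem isOpen_annCyl (a b c : ℝ) : IsOpen (annCyl a b c) := by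
  have h2 : Continuous fun y : ℝ³ => |y 2| := continuous_abs.comp (PiLp.continuous_apply 2 _ 2)
  exact ((isOpen_lt continuous_const continuous_cylRadius).inter
    ((isOpen_lt continuous_cylRadius continuous_const).inter (isOpen_lt h2 continuous_const)))

/-- Closed annular cylinders are closed. [folklore] -/
theorem isClosed_annCylClosed (a b c : ℝ) : IsClosed (annCylClosed a b c) := by
  have h2 : Continuous fun y : ℝ³ => |y 2| := continuous_abs.comp (PiLp.continuous_apply 2 _ 2)
  exact ((isClosed_le continuous_const continuous_cylRadius).inter
    ((isClosed_le continuous_cylRadius continuous_const).inter (isClosed_le h2 continuous_const)))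

/-- Closed annular cylinders are bounded. [folklore] -/
theorem isBounded_annCylClosed (a b c : ℝ) : Bornology.IsBounded (annCylClosed a b c) := by
  refine (Metric.isBounded_closedBall (x := (0 : ℝ³)) (r := |b| + |c|)).subset fun y hy => ?_
  rw [mem_closedBall, dist_zero_right]
  have hn : ‖y‖ ^ 2 = cylRadius y ^ 2 + y 2 ^ 2 := by
    rw [EuclideanSpace.real_norm_sq_eq, Fin.sum_univ_three, cylRadius_sq]
  have hr : cylRadius y ≤ |b| := hy.2.1.trans (le_abs_self b)
  have hz : |y 2| ≤ |c| := hy.2.2.trans (le_abs_self c)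
  have hr0 := cylRadius_nonneg y
  have : ‖y‖ ^ 2 ≤ (|b| + |c|) ^ 2 := by
    rw [hn]
    nlinarith [abs_nonneg b, abs_nonneg c, sq_abs (y 2), abs_nonneg (y 2),
      mul_le_mul hr hr hr0 (abs_nonneg b), mul_le_mul hz hz (abs_nonneg _) (abs_nonneg c)]
  exact (pow_le_pow_iff_left₀ (norm_nonneg y) (by positivity) two_ne_zero).1 this

/-- Closed annular cylinders are compact. [folklore] -/
theorem isCompact_annCylClosed (a b c : ℝ) : IsCompact (annCylClosed a b c) :=
  Metric.isCompact_of_isClosed_isBounded (isClosed_annCylClosed a b c) (isBounded_annCylClosed a b c)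

/-- Open annular cylinders are bounded. [folklore] -/
theorem isBounded_annCyl (a b c : ℝ) : Bornology.IsBounded (annCyl a b c) :=
  (isBounded_annCylClosed a b c).subset fun _ hy => ⟨hy.1.le, hy.2.1.le, hy.2.2.le⟩

/-- The closure of an open annular cylinder lies in the closed one. [folklore] -/
theorem closure_annCyl_subset (a b c : ℝ) : closure (annCyl a b c) ⊆ annCylClosed a b c :=
  closure_minimal (fun _ hy => ⟨hy.1.le, hy.2.1.le, hy.2.2.le⟩) (isClosed_annCylClosed a b c)

/-- Monotonicity: a closed annular cylinder lies in a larger open one. [folklore] -/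
theorem annCylClosed_subset_annCyl {a b c a' b' c' : ℝ} (ha : a' < a) (hb : b < b') (hc : c < c') :
    annCylClosed a b c ⊆ annCyl a' b' c' :=
  fun _ hy => ⟨lt_of_lt_of_le ha hy.1, lt_of_le_of_lt hy.2.1 hb, lt_of_le_of_lt hy.2.2 hc⟩

/-- **Open annular cylinders (with `0 ≤ a`) are connected**: they are the image of the convex set
`(a, b) × ℝ × (−c, c)` under the continuous cylindrical-coordinate map
`(ρ, θ, z) ↦ (ρ cos θ, ρ sin θ, z)`. [folklore] -/
theorem isConnected_annCyl {a b c : ℝ} (ha : 0 ≤ a) (hab : a < b) (hc : 0 < c) :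
    IsConnected (annCyl a b c) := by
  -- the parametrisation
  set P : ℝ × ℝ × ℝ → ℝ³ := fun q => toLp 2 ![q.1 * Real.cos q.2.1, q.1 * Real.sin q.2.1, q.2.2]
    with hP
  have hPc : Continuous P := by
    rw [hP]
    fun_prop
  have hPr : ∀ q : ℝ × ℝ × ℝ, 0 ≤ q.1 → cylRadius (P q) = q.1 := by
    intro q hq
    rw [cylRadius]
    simp only [hP, PiLp.toLp_apply, Matrix.cons_val_zero, Matrix.cons_val_one]
    rw [show (q.1 * Real.cos q.2.1) ^ 2 + (q.1 * Real.sin q.2.1) ^ 2 = q.1 ^ 2 by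
      linear_combination q.1 ^ 2 * Real.cos_sq_add_sin_sq q.2.1, Real.sqrt_sq hq]
  set D : Set (ℝ × ℝ × ℝ) := Ioo a b ×ˢ (univ ×ˢ Ioo (-c) c) with hD
  have hDconn : IsConnected D := by
    refine ⟨⟨((a + b) / 2, 0, 0), ⟨by constructor <;> linarith, mem_univ _, by constructor <;> linarith⟩⟩,
      ?_⟩
    exact (convex_Ioo a b).isPreconnected.prod
      (convex_univ.isPreconnected.prod (convex_Ioo (-c) c).isPreconnected)
  have himage : P '' D = annCyl a b c := by
    ext y
    constructor
    · rintro ⟨q, ⟨hq1, -, hq3⟩, rfl⟩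
      have hq0 : 0 ≤ q.1 := ha.trans hq1.1.le
      refine ⟨by rw [hPr q hq0]; exact hq1.1, by rw [hPr q hq0]; exact hq1.2, ?_⟩
      simp only [hP, PiLp.toLp_apply]
      exact abs_lt.2 hq3
    · rintro ⟨h1, h2, h3⟩
      refine ⟨(cylRadius y, Complex.arg ⟨y 0, y 1⟩, y 2), ⟨⟨h1, h2⟩, mem_univ _, abs_lt.1 h3⟩, ?_⟩
      have key : P (cylRadius y, Complex.arg ⟨y 0, y 1⟩, y 2) =
          rotZ (Complex.arg ⟨y 0, y 1⟩) (meridianPoint (meridian y)) := by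
        ext i
        fin_cases i <;> simp [hP, rotZ, meridianPoint, mul_comm]
      rw [key, rotZ_arg_meridianPoint]
  rw [← himage]
  exact hDconn.image P hPc.continuousOn

/-- Points of an annular cylinder with `a ≥ 1/2` are at distance `> 1/2` from the axis.
[folklore] -/
theorem cylRadius_gt_of_mem_annCyl {a b c : ℝ} (ha : 1 / 2 ≤ a) {y : ℝ³} (hy : y ∈ annCyl a b c) :
    1 / 2 < cylRadius y :=
  lt_of_le_of_lt ha hy.1

end Geometry

/-! ### The Lemma 2.1 step: the rescaled swirl is `≥ M − ε` on a long annular cylinder -/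

section Plateau

variable {Cf Cu : ℝ} {f : ℝ → ℝ³ → ℝ} {u : ℝ → ℝ³ → ℝ³}

/-- **The Lemma 2.1 step of the proof of Theorem 5.3** (KNSS 2009, arXiv p. 10: "By re-scaling
`f → f^λ` we can move points where `f^λ` is "almost equal to `M`" close to the `x₃`-axis. Using
this and Lemma 2.1, we see that for any (large) `T₁ > 0`, `L > 0` and `R > 0` and any (small)
`ε > 0` we can find `λ > 0` such that `f^λ ≥ M − ε` in a space-time region
`P = {δ ≤ r ≤ δ+R, −L+z̄ ≤ x₃ ≤ L+z̄} × (t̄ − T₁, t̄)`", here with `δ = R = 1`, `z̄ = 0`,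
`t̄ = T`, `T₁ = T − 1`). For a swirl pair on `(−∞, 0)` whose scalar has supremum `M > 0`,
approached and with near-maxima off the axis, and for `L ≥ 1`, `T`, `ε > 0`, there are
`λ > 0`, `t* < 0`, `z̄` such that the rescaled scalar `f(t* + λ²(s − T), z̄e_z + λy)` is
`≥ M − ε` for `s ∈ (1, T)`, `1 ≤ r(y) ≤ 2`, `|y₂| ≤ L`. Proof: Lemma 2.1 (`KNSS2009_lemma21`) on
`Ω = {1/2 < r < 3, |z| < L+1} ⊃ Ω' = {3/4 < r < 5/2, |z| < L+1/2} ⊃ K = {1 ≤ r ≤ 2, |z| ≤ L}`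
with final time `T`, `τ = 1`, drift bound `2C_u + 4`, `ε' = ε/(M + C_f)`, applied to
`g = f^λ + C_f ≥ 0` (`IsKNSSSwirlPair.lemma21_data`), where `λ = 2r*/3` and the translations put
a point with `f > M − min(δ(M + C_f), M/2)` at `(T, y₀)`, `r(y₀) = 3/2`, `(y₀)₂ = 0`. [cite: KochNadirashviliSereginSverak2009, proof of Thm 5.3, (5.14) (arXiv p. 10)] -/
theorem IsKNSSSwirlPair.exists_rescale_ge (hL21 : KNSS2009_lemma21 (EuclideanSpace ℝ (Fin 3)))
    (h : IsKNSSSwirlPair Cf Cu 0 f u) {M : ℝ} (hM : 0 < M) (hfM : ∀ t < 0, ∀ x, f t x ≤ M)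
    (happr : ∀ η > 0, ∃ t < 0, ∃ x, M - η < f t x ∧ (η ≤ M → cylRadius x ≠ 0))
    {L T ε : ℝ} (hL : 1 ≤ L) (hε : 0 < ε) :
    ∃ lam > 0, ∃ tstar < (0 : ℝ), ∃ zbar : ℝ,
      ∀ s ∈ Ioo 1 T, ∀ y ∈ annCylClosed 1 2 L,
        M - ε ≤ stPull (lam ^ 2) lam (tstar - lam ^ 2 * T) (zbar • eZ) f s y := by
  have hCf := h.Cf_nonneg
  have hCu := h.Cu_nonneg
  set M' : ℝ := M + Cf with hM'
  have hM'pos : 0 < M' := by positivity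
  -- the configuration of Lemma 2.1
  set Ω : Set ℝ³ := annCyl (1 / 2) 3 (L + 1) with hΩ
  set Ω' : Set ℝ³ := annCyl (3 / 4) (5 / 2) (L + 1 / 2) with hΩ'
  set K : Set ℝ³ := annCylClosed 1 2 L with hK
  have hΩo : IsOpen Ω := isOpen_annCyl _ _ _
  have hΩb : Bornology.IsBounded Ω := isBounded_annCyl _ _ _
  have hΩc : IsConnected Ω := isConnected_annCyl (by norm_num) (by norm_num) (by linarith)
  have hcl : closure Ω' ⊆ Ω :=
    (closure_annCyl_subset _ _ _).trans (annCylClosed_subset_annCyl (by norm_num) (by norm_num)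
      (by linarith))
  have hKc : IsCompact K := isCompact_annCylClosed _ _ _
  have hKΩ : K ⊆ Ω := annCylClosed_subset_annCyl (by norm_num) (by norm_num) (by linarith)
  have hKΩ' : K ⊆ Ω' := annCylClosed_subset_annCyl (by norm_num) (by norm_num) (by linarith)
  have hΩr : ∀ y ∈ Ω, 1 / 2 < cylRadius y := fun y hy => cylRadius_gt_of_mem_annCyl le_rfl hy
  obtain ⟨δ, hδ, hP⟩ := hL21 (T := T) (A := 2 * Cu + 4) hΩo hΩb hΩc hcl hKc hKΩ one_pos
    (div_pos hε hM'pos : 0 < ε / M')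
  -- a near-maximum point off the axis
  set η : ℝ := min (M' * δ) (M / 2) with hη
  have hηpos : 0 < η := lt_min (by positivity) (by positivity)
  obtain ⟨tstar, htstar, xstar, hnear, hoff⟩ := happr η hηpos
  have hr : cylRadius xstar ≠ 0 := hoff ((min_le_right _ _).trans (by linarith))
  have hrpos : 0 < cylRadius xstar := lt_of_le_of_ne (cylRadius_nonneg _) (Ne.symm hr)
  -- the scaling and the translations
  set lam : ℝ := cylRadius xstar / (3 / 2) with hlam
  have hlampos : 0 < lam := by positivity
  set zbar : ℝ := xstar 2 with hzbar
  refine ⟨lam, hlampos, tstar, htstar, zbar, ?_⟩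
  -- the rescaled pair and the shifted scalar
  have hresc := h.rescale hlampos tstar zbar T
  set F := stPull (lam ^ 2) lam (tstar - lam ^ 2 * T) (zbar • eZ) f with hF
  set V := lam • stPull (lam ^ 2) lam (tstar - lam ^ 2 * T) (zbar • eZ) u with hV
  have hτ' : T < T + (0 - tstar) / lam ^ 2 := by
    have : 0 < (0 - tstar) / lam ^ 2 := div_pos (by linarith) (by positivity)
    linarith
  obtain ⟨hb_meas, hb_bd, hg_C2, hg_cont1, hg_cont2, hg_eq⟩ := hresc.lemma21_data hτ' Cf hΩr
  -- the time arguments of `F` are negative up to `T`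
  have htime : ∀ s, s ≤ T → tstar + lam ^ 2 * (s - T) < 0 := by
    intro s hs
    have : lam ^ 2 * (s - T) ≤ 0 := mul_nonpos_of_nonneg_of_nonpos (by positivity) (by linarith)
    linarith
  have hFval : ∀ s y, F s y = f (tstar + lam ^ 2 * (s - T)) (zbar • eZ + lam • y) := fun s y =>
    stPull_rescale_apply lam tstar zbar T f s y
  -- `|g| ≤ M'` on `(0, T] × Ω`
  have hg_bd : ∀ s ∈ Ioc 0 T, ∀ y ∈ Ω, |F s y + Cf| ≤ M' := by
    intro s hs y _
    rw [hFval]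
    have h1 := hfM _ (htime s hs.2) (zbar • eZ + lam • y)
    have h2 := (_root_.abs_le.1 (h.abs_le _ (htime s hs.2) (zbar • eZ + lam • y))).1
    rw [_root_.abs_le]
    constructor <;> linarith
  -- the near-maximum point sits at `(T, y₀)` with `y₀ ∈ K`
  set y₀ : ℝ³ := lam⁻¹ • (xstar - zbar • eZ) with hy₀
  have hy₀eq : zbar • eZ + lam • y₀ = xstar := by
    rw [hy₀, smul_smul, mul_inv_cancel₀ hlampos.ne', one_smul, add_sub_cancel]
  have hy₀r : cylRadius y₀ = 3 / 2 := by
    have h1 : cylRadius (zbar • eZ + lam • y₀) = lam * cylRadius y₀ := by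
      rw [cylRadius_smul_eZ_add_smul, abs_of_pos hlampos]
    rw [hy₀eq] at h1
    have h2 : cylRadius xstar = lam * (3 / 2) := by rw [hlam]; ring
    have h3 : lam * cylRadius y₀ = lam * (3 / 2) := by rw [← h1, ← h2]
    exact mul_left_cancel₀ hlampos.ne' h3
  have hy₀z : y₀ 2 = 0 := by
    simp [hy₀, hzbar, eZ]
  have hy₀K : y₀ ∈ K := by
    refine ⟨by rw [hy₀r]; norm_num, by rw [hy₀r]; norm_num, ?_⟩
    rw [hy₀z, abs_zero]; linarith
  have hnear' : ∃ x ∈ K, M' * (1 - δ) ≤ F T x + Cf := by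
    refine ⟨y₀, hy₀K, ?_⟩
    rw [hF, stPull_rescale_apply_T, hy₀eq]
    have hηδ : η ≤ M' * δ := min_le_left _ _
    nlinarith
  -- Lemma 2.1
  have key := hP hb_meas hb_bd hg_C2 hg_cont1 hg_cont2 hg_eq hM'pos hg_bd hnear'
  intro s hs y hy
  have := key s hs y (hKΩ' hy)
  have hcalc : M' * (1 - ε / M') = M' - ε := by field_simp
  rw [hcalc] at this
  linarith

end Plateau

/-! ### Joint continuity of the scalar and the null axis -/

section JointCont

variable {Cf Cu τ : ℝ} {f : ℝ → ℝ³ → ℝ} {u : ℝ → ℝ³ → ℝ³}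

/-- **The scalar of a swirl pair is jointly continuous** on `(−∞, τ) × ℝ³`: since it vanishes on
the axis, `f(t, x) = ∫₀¹ Df(t, θx)[x] dθ`, a parametric integral of a jointly continuous
integrand. [folklore] -/
theorem IsKNSSSwirlPair.continuousOn_uncurry (h : IsKNSSSwirlPair Cf Cu τ f u) :
    ContinuousOn (uncurry f) (Iio τ ×ˢ univ) := by
  set S : Set (ℝ × ℝ³) := Iio τ ×ˢ univ with hS
  -- the representation `f(t, x) = ∫₀¹ Df(t, θx)[x] dθ`
  have hrep : ∀ p ∈ S, uncurry f p = ∫ θ in (0 : ℝ)..1, fderiv ℝ (f p.1) (θ • p.2) p.2 := by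
    rintro ⟨t, x⟩ ⟨ht, -⟩
    have hd : Differentiable ℝ (f t) := (h.smooth t ht).differentiable (by simp)
    have hg : ∀ θ, HasDerivAt (fun θ : ℝ => f t (θ • x)) (fderiv ℝ (f t) (θ • x) x) θ := by
      intro θ
      have h1 : HasDerivAt (fun θ : ℝ => θ • x) x θ := by
        simpa using (hasDerivAt_id θ).smul_const x
      exact (hd (θ • x)).hasFDerivAt.comp_hasDerivAt θ h1
    have hc : Continuous fun θ : ℝ => fderiv ℝ (f t) (θ • x) x :=
      (((h.smooth t ht).continuous_fderiv (by simp)).comp (continuous_id.smul continuous_const)).clm_apply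
        continuous_const
    rw [intervalIntegral.integral_eq_sub_of_hasDerivAt (fun θ _ => hg θ) (hc.intervalIntegrable _ _)]
    simp only [uncurry_apply_pair, one_smul, zero_smul]
    rw [h.axis t ht 0 (by simp [cylRadius]), sub_zero]
  -- continuity of the parametric integral on the subtype
  have hcont : ContinuousOn (fun p : ℝ × ℝ³ => ∫ θ in (0 : ℝ)..1, fderiv ℝ (f p.1) (θ • p.2) p.2) S := by
    rw [continuousOn_iff_continuous_restrict]
    have hH : Continuous (uncurry fun (q : S) (θ : ℝ) => fderiv ℝ (f q.1.1) (θ • q.1.2) q.1.2) := by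
      have hmap : Continuous fun z : S × ℝ => ((z.1.1.1, z.2 • z.1.1.2) : ℝ × ℝ³) := by fun_prop
      have hmaps : ∀ z : S × ℝ, ((z.1.1.1, z.2 • z.1.1.2) : ℝ × ℝ³) ∈ S := fun z =>
        ⟨z.1.2.1, mem_univ _⟩
      have h1 : Continuous fun z : S × ℝ => fderiv ℝ (f z.1.1.1) (z.2 • z.1.1.2) :=
        h.continuousOn_fderiv.comp_continuous hmap hmaps
      exact h1.clm_apply (by fun_prop)
    exact intervalIntegral.continuous_parametric_intervalIntegral_of_continuous' hH 0 1
  exact hcont.congr hrep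

/-- The scalar of a swirl pair is jointly measurable on `(−∞, τ) × ℝ³` (restricted measures).
[folklore] -/
theorem IsKNSSSwirlPair.aestronglyMeasurable_uncurry (h : IsKNSSSwirlPair Cf Cu τ f u)
    {μ : Measure (ℝ × ℝ³)} {S : Set (ℝ × ℝ³)} (hS : MeasurableSet S) (hSτ : S ⊆ Iio τ ×ˢ univ) :
    AEStronglyMeasurable (uncurry f) (μ.restrict S) :=
  (h.continuousOn_uncurry.mono hSτ).aestronglyMeasurable hS

/-- The axis `{r = 0}` is Lebesgue-null (a restatement of `volume_axis_eq_zero`, file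
`AxisymWeights`, through `cylRadius_eq_zero_iff`). [folklore] -/
theorem volume_cylRadius_eq_zero : volume {y : ℝ³ | cylRadius y = 0} = 0 := by
  refine measure_mono_null (fun y hy => ?_) volume_axis_eq_zero
  rw [mem_setOf_eq, cylRadius_eq_zero_iff] at hy
  show y 0 ^ 2 + y 1 ^ 2 = 0
  simp [hy.1, hy.2]

/-- Almost every point of `ℝ³` is off the axis. [folklore] -/
theorem ae_cylRadius_ne_zero : ∀ᵐ y ∂(volume : Measure ℝ³), cylRadius y ≠ 0 := by
  rw [ae_iff]
  simpa using volume_cylRadius_eq_zero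

end JointCont

/-! ### Spatial integrations by parts on a time slice -/

section SliceIBP

/-- **Green's second identity without boundary for scalars** (`∫ (F − M) Δφ = ∫ ΔF φ` for
`F ∈ C²`, `φ ∈ C²_c`; KNSS 2009, (5.17), the term `III`). [cite: KochNadirashviliSereginSverak2009, proof of Thm 5.3, (5.17) (arXiv p. 10)] -/
theorem integral_sub_const_mul_laplacian_eq {F φ : ℝ³ → ℝ} (hF : ContDiff ℝ 2 F) (hφ : ContDiff ℝ 2 φ)
    (hφc : HasCompactSupport φ) (M : ℝ) :
    ∫ y, (F y - M) * (Δ φ) y = ∫ y, (Δ F) y * φ y := by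
  set b := stdOrthonormalBasis ℝ ℝ³ with hb
  have hFM : ContDiff ℝ 2 fun y => F y - M := hF.sub contDiff_const
  have h1 := integral_inner_laplacian_add_eq_zero b (v := φ) (w := fun y => F y - M) hφ
    (hFM.of_le (by norm_num)) (Or.inl hφc)
  have h2 := integral_inner_laplacian_add_eq_zero b (v := fun y => F y - M) (w := φ) hFM
    (hφ.of_le (by norm_num)) (Or.inr hφc)
  have hsum : ∑ i, ∫ y, ⟪fderiv ℝ φ y (b i), fderiv ℝ (fun y => F y - M) y (b i)⟫ =
      ∑ i, ∫ y, ⟪fderiv ℝ (fun y => F y - M) y (b i), fderiv ℝ φ y (b i)⟫ := by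
    refine Finset.sum_congr rfl fun i _ => integral_congr_ae (Eventually.of_forall fun y => ?_)
    exact real_inner_comm _ _
  have hΔ : ∀ y, (Δ fun y => F y - M) y = (Δ F) y := fun y => by
    rw [show (fun y => F y - M) = fun y => F y + (-M) from funext fun y => sub_eq_add_neg _ _]
    exact laplacian_add_const hF.contDiffAt (-M)
  have key : ∫ y, ⟪(Δ φ) y, F y - M⟫ = ∫ y, ⟪(Δ fun y => F y - M) y, φ y⟫ := by linarith
  simp only [RCLike.inner_apply, conj_trivial, hΔ] at key
  rw [key]
  exact integral_congr_ae (Eventually.of_forall fun y => mul_comm _ _)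

/-- **The convective term integrates by parts against a divergence-free drift**
(`∫ (F − M) Dφ[V] = −∫ DF[V] φ` for `V ∈ C¹` with `div V = 0`, `F ∈ C¹`, `φ ∈ C¹_c`; KNSS 2009,
(5.17), the term `II`, "we can change `f^λ` to `f^λ − M` and integrate by parts"). [cite: KochNadirashviliSereginSverak2009, proof of Thm 5.3, (5.17) (arXiv p. 10)] -/
theorem integral_sub_const_mul_fderiv_apply_eq {F φ : ℝ³ → ℝ} {V : ℝ³ → ℝ³} (hV : ContDiff ℝ 1 V)
    (hdiv : VectorCalculus.IsDivFree V) (hF : ContDiff ℝ 1 F) (hφ : ContDiff ℝ 1 φ)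
    (hφc : HasCompactSupport φ) (M : ℝ) :
    ∫ y, (F y - M) * fderiv ℝ φ y (V y) = -∫ y, fderiv ℝ F y (V y) * φ y := by
  have hFM : ContDiff ℝ 1 fun y => F y - M := hF.sub contDiff_const
  have h := integral_inner_convect_add_eq_zero (u := V) (v := fun y => F y - M) (w := φ) hV hFM hφ hφc
  have h0 : ∫ y, VectorCalculus.divergence V y * ⟪F y - M, φ y⟫ = 0 := by
    refine integral_eq_zero_of_ae (Eventually.of_forall fun y => ?_)
    simp [hdiv y]
  rw [h0, add_zero] at h
  simp only [convect_apply, fderiv_sub_const, RCLike.inner_apply, conj_trivial] at h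
  have h1 : ∫ y, (F y - M) * fderiv ℝ φ y (V y) = ∫ y, fderiv ℝ φ y (V y) * (F y - M) :=
    integral_congr_ae (Eventually.of_forall fun y => mul_comm _ _)
  have h2 : ∫ y, fderiv ℝ F y (V y) * φ y = ∫ y, φ y * fderiv ℝ F y (V y) :=
    integral_congr_ae (Eventually.of_forall fun y => mul_comm _ _)
  linarith

/-- Compactly supported functions: `fderiv φ · (V ·)` has compact support. [folklore] -/
theorem HasCompactSupport.fderiv_apply_fun {φ : ℝ³ → ℝ} (hφc : HasCompactSupport φ) (V : ℝ³ → ℝ³) :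
    HasCompactSupport fun y => fderiv ℝ φ y (V y) :=
  (hφc.fderiv (𝕜 := ℝ)).mono fun y hy => by
    contrapose! hy
    simp only [Function.mem_support, not_not] at hy ⊢
    rw [hy, zero_apply]

/-- Compactly supported functions: `Δφ` has compact support. [folklore] -/
theorem HasCompactSupport.laplacian_fun {φ : ℝ³ → ℝ} (hφc : HasCompactSupport φ) :
    HasCompactSupport (Δ φ) :=
  HasCompactSupport.of_support_subset_isCompact hφc.isCompact fun y hy => by
    by_contra h
    exact hy (laplacian_eq_zero_of_notMem_tsupport h)

end SliceIBP

/-! ### The integrated swirl equation tested against the cut-off: the slice identity -/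

section Identity

variable {Cf Cu τ' : ℝ} {F : ℝ → ℝ³ → ℝ} {V : ℝ → ℝ³ → ℝ³}

/-- **The slice identity** (KNSS 2009, (5.15)/(5.17)/(5.19) on one time slice): for a swirl pair
`(F, V)` on `s < τ'`, a time `s < τ'`, a constant `M` and the cut-off `φ = φ_{L,T}(s, ·)`,
`∫ (F − M)(Dφ[V] + Δφ) dy + ∫ (2/r) F Dφ[e_r] dy = ∫ (ΔF − DF[V] − (2/r)∂ᵣF) φ dy`
(convective and Laplacian terms by parts, `SliceIBP`; radial term by the axis integration by
parts of `CylindricalIntegration`, using `F = 0` on the axis). [cite: KochNadirashviliSereginSverak2009, proof of Thm 5.3, (5.15)–(5.19) (arXiv p. 10)] -/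
theorem IsKNSSSwirlPair.slice_identity (hP : IsKNSSSwirlPair Cf Cu τ' F V) {s : ℝ} (hs : s < τ')
    (L T M : ℝ) :
    (∫ y, (F s y - M) * (fderiv ℝ (phiCut L T s) y (V s y) + (Δ (phiCut L T s)) y)) +
      ∫ y, 2 / cylRadius y * (F s y * fderiv ℝ (phiCut L T s) y (eR y)) =
    ∫ y, ((Δ (F s)) y - fderiv ℝ (F s) y (V s y) -
      2 / cylRadius y * partialDeriv (eR y) (F s) y) * phiCut L T s y := by
  set φ := phiCut L T s with hφ
  have hφs : ContDiff ℝ 2 φ := contDiff_phiCut L T s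
  have hφc : HasCompactSupport φ := hasCompactSupport_phiCut L T s
  have hF2 : ContDiff ℝ 2 (F s) := (hP.smooth s hs).of_le (by norm_cast)
  have hF1 : ContDiff ℝ 1 (F s) := (hP.smooth s hs).of_le (by norm_cast)
  have hV1 : ContDiff ℝ 1 (V s) := (hP.smooth_drift s hs).of_le (by norm_cast)
  -- continuity of the ingredients
  have hcF : Continuous (F s) := hF1.continuous
  have hcFM : Continuous fun y => F s y - M := hcF.sub continuous_const
  have hcDφV : Continuous fun y => fderiv ℝ φ y (V s y) :=
    (hφs.continuous_fderiv (by norm_num)).clm_apply hV1.continuous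
  have hcΔφ : Continuous (Δ φ) := continuous_laplacian hφs
  have hcΔF : Continuous (Δ (F s)) := continuous_laplacian hF2
  have hcDFV : Continuous fun y => fderiv ℝ (F s) y (V s y) :=
    (hF1.continuous_fderiv one_ne_zero).clm_apply hV1.continuous
  have hcφ : Continuous φ := hφs.continuous
  -- integrability of the four regular products
  have hi1 : Integrable fun y => (F s y - M) * fderiv ℝ φ y (V s y) :=
    (hcFM.mul hcDφV).integrable_of_hasCompactSupport
      (HasCompactSupport.fderiv_apply_fun hφc (V s)).mul_left
  have hi2 : Integrable fun y => (F s y - M) * (Δ φ) y :=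
    (hcFM.mul hcΔφ).integrable_of_hasCompactSupport (HasCompactSupport.laplacian_fun hφc).mul_left
  have hi3 : Integrable fun y => (Δ (F s)) y * φ y :=
    (hcΔF.mul hcφ).integrable_of_hasCompactSupport hφc.mul_left
  have hi4 : Integrable fun y => fderiv ℝ (F s) y (V s y) * φ y :=
    (hcDFV.mul hcφ).integrable_of_hasCompactSupport hφc.mul_left
  -- the axis integration by parts
  obtain ⟨hi5, hi6, haxis⟩ := integrable_and_integral_two_div_cylRadius_mul_fderiv_eR hF1
    (hφs.of_le (by norm_num)) hφc (hP.axisymmetric s hs) (isAxisymmetricScalar_phiCut L T s)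
    (hP.axis s hs)
  -- the two regular integrations by parts
  have hconv := integral_sub_const_mul_fderiv_apply_eq hV1 (hP.divFree s hs) hF1
    (hφs.of_le (by norm_num)) hφc M
  have hgreen := integral_sub_const_mul_laplacian_eq hF2 hφs hφc M
  -- assemble
  have hL : ∫ y, (F s y - M) * (fderiv ℝ φ y (V s y) + (Δ φ) y) =
      (∫ y, (F s y - M) * fderiv ℝ φ y (V s y)) + ∫ y, (F s y - M) * (Δ φ) y := by
    rw [← integral_add hi1 hi2]
    exact integral_congr_ae (Eventually.of_forall fun y => by ring)
  have hi34 : Integrable fun y => (Δ (F s)) y * φ y - fderiv ℝ (F s) y (V s y) * φ y :=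
    hi3.sub hi4
  have hR : ∫ y, ((Δ (F s)) y - fderiv ℝ (F s) y (V s y) -
      2 / cylRadius y * partialDeriv (eR y) (F s) y) * φ y =
      (∫ y, (Δ (F s)) y * φ y) - (∫ y, fderiv ℝ (F s) y (V s y) * φ y) -
        ∫ y, 2 / cylRadius y * (fderiv ℝ (F s) y (eR y) * φ y) := by
    rw [← integral_sub hi3 hi4, ← integral_sub hi34 hi5]
    refine integral_congr_ae (Eventually.of_forall fun y => ?_)
    simp only [partialDeriv_apply]
    ring
  rw [hL, hR, hconv, hgreen, haxis]
  ring

/-- The closed solid cylinder `{r ≤ a, |z| ≤ b}` is compact. [folklore] -/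
theorem isCompact_solidCylinder (a b : ℝ) : IsCompact (solidCylinder a b) := by
  have hsub : solidCylinder a b ⊆ annCylClosed 0 a b := fun y hy => ⟨cylRadius_nonneg y, hy.1, hy.2⟩
  have hcl : IsClosed (solidCylinder a b) := by
    have h2 : Continuous fun y : ℝ³ => |y 2| := continuous_abs.comp (PiLp.continuous_apply 2 _ 2)
    exact (isClosed_le continuous_cylRadius continuous_const).inter (isClosed_le h2 continuous_const)
  exact (isCompact_annCylClosed 0 a b).of_isClosed_subset hcl hsub

/-- **The integrand of the time-integrated swirl equation**,
`G(s, y) = ΔF(s, ·)(y) − DF(s, ·)(y)[V(s, y)] − (2/r) ∂ᵣF(s, ·)(y)`. [folklore] -/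
def swirlEqnIntegrand (F : ℝ → ℝ³ → ℝ) (V : ℝ → ℝ³ → ℝ³) (s : ℝ) (y : ℝ³) : ℝ :=
  (Δ (F s)) y - fderiv ℝ (F s) y (V s y) - 2 / cylRadius y * partialDeriv (eR y) (F s) y

/-- **The time identity on a line off the axis** (KNSS 2009, (5.15)/(5.17), the term `I`): for a
swirl pair on `s < τ'`, `0 ≤ T < τ'`, `y` off the axis and any constant `M`,
`∫₀ᵀ (F(s,y) − M) ∂ₛφ(s,y) ds = −∫₀ᵀ G(s,y) φ(s,y) ds`, `G` the integrand of the integrated swirl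
equation (`swirlEqnIntegrand`); here `∂ₛφ = ψ_L(y) ζ_T'(s)` and `φ(0,·) = φ(T,·) = 0`. [cite: KochNadirashviliSereginSverak2009, proof of Thm 5.3, (5.15)–(5.17) (arXiv p. 10)] -/
theorem IsKNSSSwirlPair.time_identity (hP : IsKNSSSwirlPair Cf Cu τ' F V) {L T : ℝ} (hT0 : 0 ≤ T)
    (hTτ : T < τ') (M : ℝ) {y : ℝ³} (hy : cylRadius y ≠ 0) :
    ∫ s in (0 : ℝ)..T, (F s y - M) * (psiCut L y * deriv (zetaCut T) s) =
      -∫ s in (0 : ℝ)..T, swirlEqnIntegrand F V s y * phiCut L T s y := by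
  have hτ : ∀ s ∈ Icc (0 : ℝ) T, s < τ' := fun s hs => lt_of_le_of_lt hs.2 hTτ
  -- the integrand `G(·, y)` is integrable on `[0, T]`
  have hslab : MapsTo (fun s : ℝ => ((s, y) : ℝ × ℝ³)) (Icc 0 T) (Iio τ' ×ˢ univ) :=
    fun s hs => ⟨hτ s hs, mem_univ _⟩
  have hcs : Continuous fun s : ℝ => ((s, y) : ℝ × ℝ³) := by fun_prop
  have hA : ContinuousOn (fun s => (Δ (F s)) y) (Icc 0 T) := by
    have h := hP.continuousOn_laplacian.comp hcs.continuousOn hslab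
    simpa only [Function.comp_def] using h
  have hB : ContinuousOn (fun s => fderiv ℝ (F s) y) (Icc 0 T) := by
    have h := hP.continuousOn_fderiv.comp hcs.continuousOn hslab
    simpa only [Function.comp_def] using h
  have hVm : Measurable fun s => V s y := by
    have h : Measurable fun s : ℝ => ((s, y) : ℝ × ℝ³) := measurable_id.prodMk measurable_const
    exact hP.measurable_drift.comp h
  obtain ⟨KB, hKB⟩ := (isCompact_Icc (a := (0 : ℝ)) (b := T)).exists_bound_of_continuousOn hB
  have hGint : IntegrableOn (fun s => swirlEqnIntegrand F V s y) (Icc 0 T) := by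
    have hA' : IntegrableOn (fun s => (Δ (F s)) y) (Icc 0 T) := hA.integrableOn_compact isCompact_Icc
    have hD' : IntegrableOn (fun s => 2 / cylRadius y * fderiv ℝ (F s) y (eR y)) (Icc 0 T) :=
      ((hB.clm_apply continuousOn_const).integrableOn_compact isCompact_Icc).const_mul _
    have hBV : IntegrableOn (fun s => fderiv ℝ (F s) y (V s y)) (Icc 0 T) := by
      have hmeas : AEStronglyMeasurable (fun s => fderiv ℝ (F s) y (V s y))
          (volume.restrict (Icc 0 T)) := by
        have h1 : AEStronglyMeasurable (fun s => fderiv ℝ (F s) y) (volume.restrict (Icc 0 T)) :=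
          hB.aestronglyMeasurable measurableSet_Icc
        have h2 : AEStronglyMeasurable (fun s => V s y) (volume.restrict (Icc 0 T)) :=
          hVm.aestronglyMeasurable
        exact (isBoundedBilinearMap_apply (𝕜 := ℝ) (E := ℝ³) (F := ℝ)).continuous.comp_aestronglyMeasurable
          (h1.prodMk h2)
      refine Integrable.mono' (integrableOn_const (C := KB * (Cu / cylRadius y))
        (by exact measure_Icc_lt_top.ne)) hmeas ?_
      rw [ae_restrict_iff' measurableSet_Icc]
      refine Eventually.of_forall fun s hs => ?_
      have hr : 0 < cylRadius y := lt_of_le_of_ne (cylRadius_nonneg y) (Ne.symm hy)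
      have hV : ‖V s y‖ ≤ Cu / cylRadius y := by
        rw [le_div_iff₀ hr, mul_comm]; exact hP.drift_le s (hτ s hs) y
      rw [Real.norm_eq_abs, ← Real.norm_eq_abs]
      exact ((fderiv ℝ (F s) y).le_opNorm _).trans (mul_le_mul (hKB s hs) hV (norm_nonneg _)
        ((norm_nonneg _).trans (hKB s hs)))
    have : IntegrableOn (fun s => (Δ (F s)) y - fderiv ℝ (F s) y (V s y) -
        2 / cylRadius y * fderiv ℝ (F s) y (eR y)) (Icc 0 T) := (hA'.sub hBV).sub hD'
    simpa only [swirlEqnIntegrand, partialDeriv_apply] using this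
  -- apply the one-dimensional integration by parts
  have hg : IntervalIntegrable (fun s => swirlEqnIntegrand F V s y) volume 0 T :=
    (intervalIntegrable_iff_integrableOn_Ioc_of_le hT0).2 (hGint.mono_set Ioc_subset_Icc_self)
  have hΦ : ∀ s ∈ Icc (0 : ℝ) T, F s y = F 0 y + ∫ r in (0 : ℝ)..s, swirlEqnIntegrand F V r y := by
    intro s hs
    have h := hP.eqn y hy 0 s hs.1 (hτ s hs)
    simp only [swirlEqnIntegrand]
    linarith
  have hψ : ContDiff ℝ 1 fun s => phiCut L T s y :=
    show ContDiff ℝ 1 (fun s => psiCut L y * zetaCut T s) from contDiff_const.mul (contDiff_zetaCut T)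
  have hψ0 : phiCut L T 0 y = 0 :=
    phiCut_eq_zero_of_not_mem_Ioo (fun h => by linarith [h.1]) y
  have hψT : phiCut L T T y = 0 :=
    phiCut_eq_zero_of_not_mem_Ioo (fun h => lt_irrefl _ h.2) y
  have key := integral_sub_const_mul_deriv_eq_neg (Φ := fun s => F s y)
    (g := fun s => swirlEqnIntegrand F V s y) (ψ := fun s => phiCut L T s y) hT0 hg hΦ hψ hψ0 hψT M
  rw [← key]
  refine intervalIntegral.integral_congr fun s _ => ?_
  simp only [(hasDerivAt_phiCut L T s y).deriv]

end Identity

/-! ### The space–time identity -/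

section SpaceTime

variable {Cf Cu τ' : ℝ} {F : ℝ → ℝ³ → ℝ} {V : ℝ → ℝ³ → ℝ³}

/-- Outside the closed cylinder `{r ≤ 2, |z| ≤ L}` the cut-off, its gradient and its Laplacian
vanish. [folklore] -/
theorem phiCut_derivs_eq_zero_of_not_mem {L T s : ℝ} {y : ℝ³} (hy : y ∉ solidCylinder 2 L) :
    phiCut L T s y = 0 ∧ fderiv ℝ (phiCut L T s) y = 0 ∧ (Δ (phiCut L T s)) y = 0 ∧ psiCut L y = 0 := by
  have h1 : y ∉ tsupport (phiCut L T s) := fun h => hy (tsupport_phiCut_subset L T s h)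
  have h2 : y ∉ tsupport (psiCut L) := fun h => hy (tsupport_psiCut_subset L h)
  exact ⟨image_eq_zero_of_notMem_tsupport h1, fderiv_of_notMem_tsupport ℝ h1,
    laplacian_eq_zero_of_notMem_tsupport h1, image_eq_zero_of_notMem_tsupport h2⟩

/-- The gradient of the cut-off as a jointly continuous function of `(s, y)`:
`Dφ(s, ·)(y) = ζ(s) Dψ(y)`. [folklore] -/
theorem fderiv_phiCut_eq (L T s : ℝ) (y : ℝ³) :
    fderiv ℝ (phiCut L T s) y = zetaCut T s • fderiv ℝ (psiCut L) y := by
  have hd : DifferentiableAt ℝ (psiCut L) y := (contDiff_psiCut L (n := 1)).differentiable one_ne_zero y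
  exact fderiv_mul_const hd (zetaCut T s)

/-- The Laplacian of the cut-off as a jointly continuous function of `(s, y)`:
`Δφ(s, ·)(y) = ζ(s) Δψ(y)`. [folklore] -/
theorem laplacian_phiCut_eq (L T s : ℝ) (y : ℝ³) :
    (Δ (phiCut L T s)) y = zetaCut T s * (Δ (psiCut L)) y := by
  have hfun : phiCut L T s = zetaCut T s • psiCut L := by
    funext w; simp [phiCut, mul_comm]
  rw [hfun, InnerProductSpace.laplacian_smul _ (contDiff_psiCut L (n := 2)).contDiffAt, smul_eq_mul]

/-- **The space–time identity** (KNSS 2009, (5.15)–(5.20) integrated): for a swirl pair `(F, V)`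
on `s < τ'`, `0 ≤ T < τ'`, a constant `M` and the cut-off `φ = φ_{L,T}`, the three space–time
integrals `∫∫ (F − M) ∂ₛφ`, `∫∫ (F − M)(Dφ[V] + Δφ)`, `∫∫ (2/r) F Dφ[e_r]` (time over `(0, T]`,
space over `ℝ³`) are absolutely convergent, the inner space integrals are integrable in time, and
their sum vanishes: `∫∫ (F − M)(∂ₛφ + V·∇φ + Δφ) dy ds = −∫∫ (2/r) F φ_{,r} dy ds` (the identity
(5.15) = (5.17) + (5.19): time integration by parts on every line off the axis
(`time_identity`), Fubini, and the slice identity). [cite: KochNadirashviliSereginSverak2009, proof of Thm 5.3, (5.15)–(5.19) (arXiv p. 10)] -/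
theorem IsKNSSSwirlPair.spaceTime_identity (hP : IsKNSSSwirlPair Cf Cu τ' F V) {L T : ℝ}
    (hT0 : 0 ≤ T) (hTτ : T < τ') (M : ℝ) :
    Integrable (fun s => ∫ y, (F s y - M) * (psiCut L y * deriv (zetaCut T) s))
      (volume.restrict (Ioc 0 T)) ∧
    Integrable (fun s => ∫ y, (F s y - M) *
      (fderiv ℝ (phiCut L T s) y (V s y) + (Δ (phiCut L T s)) y)) (volume.restrict (Ioc 0 T)) ∧
    Integrable (fun s => ∫ y, 2 / cylRadius y * (F s y * fderiv ℝ (phiCut L T s) y (eR y)))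
      (volume.restrict (Ioc 0 T)) ∧
    (∫ s in Ioc 0 T, ∫ y, (F s y - M) * (psiCut L y * deriv (zetaCut T) s)) +
      ∫ s in Ioc 0 T, ((∫ y, (F s y - M) *
        (fderiv ℝ (phiCut L T s) y (V s y) + (Δ (phiCut L T s)) y)) +
        ∫ y, 2 / cylRadius y * (F s y * fderiv ℝ (phiCut L T s) y (eR y))) = 0 := by
  -- the product measure and its description as a restriction
  set μT : Measure (ℝ × ℝ³) := (volume.restrict (Ioc 0 T)).prod volume with hμT
  have hμT' : μT = (volume.prod volume).restrict (Ioc 0 T ×ˢ univ) :=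
    Measure.restrict_prod_eq_prod_univ _
  have hslabm : MeasurableSet (Ioc (0 : ℝ) T ×ˢ (univ : Set ℝ³)) :=
    measurableSet_Ioc.prod MeasurableSet.univ
  have hsub : Ioc (0 : ℝ) T ×ˢ (univ : Set ℝ³) ⊆ Iio τ' ×ˢ univ :=
    fun p hp => ⟨lt_of_le_of_lt hp.1.2 hTτ, mem_univ _⟩
  have hτ : ∀ s ∈ Ioc (0 : ℝ) T, s < τ' := fun s hs => lt_of_le_of_lt hs.2 hTτ
  -- a.e. on `μT`: the time lies in `(0, T]` and the point is off the axis
  have hae : ∀ᵐ p ∂μT, p.1 ∈ Ioc 0 T ∧ cylRadius p.2 ≠ 0 := by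
    have h1 : ∀ᵐ p ∂μT, p ∈ Ioc (0 : ℝ) T ×ˢ (univ : Set ℝ³) := by
      rw [hμT']; exact ae_restrict_mem hslabm
    have h2 : ∀ᵐ p ∂μT, cylRadius p.2 ≠ 0 :=
      (Measure.quasiMeasurePreserving_snd (μ := volume.restrict (Ioc (0 : ℝ) T))
        (ν := (volume : Measure ℝ³))).ae ae_cylRadius_ne_zero
    filter_upwards [h1, h2] with p hp1 hp2
    exact ⟨hp1.1, hp2⟩
  -- measurability tools
  have hAE_cont : ∀ {g : ℝ × ℝ³ → ℝ}, ContinuousOn g (Iio τ' ×ˢ univ) → AEStronglyMeasurable g μT := by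
    intro g hg
    rw [hμT']
    exact (hg.mono hsub).aestronglyMeasurable hslabm
  have happly : Continuous fun q : (ℝ³ →L[ℝ] ℝ) × ℝ³ => q.1 q.2 :=
    (isBoundedBilinearMap_apply (𝕜 := ℝ) (E := ℝ³) (F := ℝ)).continuous
  have hAE_DF : ∀ {v : ℝ × ℝ³ → ℝ³}, Measurable v →
      AEStronglyMeasurable (fun p : ℝ × ℝ³ => fderiv ℝ (F p.1) p.2 (v p)) μT := by
    intro v hv
    have h1 : AEStronglyMeasurable (fun p : ℝ × ℝ³ => fderiv ℝ (F p.1) p.2) μT := by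
      rw [hμT']
      exact (hP.continuousOn_fderiv.mono hsub).aestronglyMeasurable hslabm
    exact happly.comp_aestronglyMeasurable (h1.prodMk hv.aestronglyMeasurable)
  have hVm : Measurable fun p : ℝ × ℝ³ => V p.1 p.2 := hP.measurable_drift
  have heRm : Measurable fun p : ℝ × ℝ³ => eR p.2 := measurable_eR.comp measurable_snd
  have hFc : ContinuousOn (fun p : ℝ × ℝ³ => F p.1 p.2 - M) (Iio τ' ×ˢ univ) :=
    hP.continuousOn_uncurry.sub continuousOn_const
  have hζ'c : Continuous (deriv (zetaCut T)) := (contDiff_zetaCut T (n := 2)).continuous_deriv (by norm_num)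
  have hψc : Continuous (psiCut L) := (contDiff_psiCut L (n := 0)).continuous
  have hDφc : Continuous fun p : ℝ × ℝ³ => fderiv ℝ (phiCut L T p.1) p.2 := by
    have h : Continuous fun p : ℝ × ℝ³ => zetaCut T p.1 • fderiv ℝ (psiCut L) p.2 :=
      ((contDiff_zetaCut T (n := 0)).continuous.comp continuous_fst).smul
        (((contDiff_psiCut L (n := 1)).continuous_fderiv one_ne_zero).comp continuous_snd)
    exact h.congr fun p => (fderiv_phiCut_eq L T p.1 p.2).symm
  have hΔφc : Continuous fun p : ℝ × ℝ³ => (Δ (phiCut L T p.1)) p.2 := by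
    have h : Continuous fun p : ℝ × ℝ³ => zetaCut T p.1 * (Δ (psiCut L)) p.2 :=
      ((contDiff_zetaCut T (n := 0)).continuous.comp continuous_fst).mul
        ((continuous_laplacian (contDiff_psiCut L (n := 2))).comp continuous_snd)
    exact h.congr fun p => (laplacian_phiCut_eq L T p.1 p.2).symm
  have hφc : Continuous fun p : ℝ × ℝ³ => phiCut L T p.1 p.2 :=
    (hψc.comp continuous_snd).mul ((contDiff_zetaCut T (n := 0)).continuous.comp continuous_fst)
  -- the four integrands are a.e. strongly measurable
  have hm1 : AEStronglyMeasurable (fun p : ℝ × ℝ³ => (F p.1 p.2 - M) *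
      (psiCut L p.2 * deriv (zetaCut T) p.1)) μT :=
    (hAE_cont hFc).mul ((hψc.comp continuous_snd).mul (hζ'c.comp continuous_fst)).aestronglyMeasurable
  have hm2 : AEStronglyMeasurable (fun p : ℝ × ℝ³ => (F p.1 p.2 - M) *
      (fderiv ℝ (phiCut L T p.1) p.2 (V p.1 p.2) + (Δ (phiCut L T p.1)) p.2)) μT :=
    (hAE_cont hFc).mul ((happly.comp_aestronglyMeasurable
      (hDφc.aestronglyMeasurable.prodMk hVm.aestronglyMeasurable)).add hΔφc.aestronglyMeasurable)
  have hm3 : AEStronglyMeasurable (fun p : ℝ × ℝ³ => 2 / cylRadius p.2 *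
      (F p.1 p.2 * fderiv ℝ (phiCut L T p.1) p.2 (eR p.2))) μT := by
    have h1 : Measurable fun p : ℝ × ℝ³ => 2 / cylRadius p.2 :=
      measurable_const.div (continuous_cylRadius.measurable.comp measurable_snd)
    have h2 : AEStronglyMeasurable (fun p : ℝ × ℝ³ => F p.1 p.2) μT := hAE_cont hP.continuousOn_uncurry
    exact h1.aestronglyMeasurable.mul (h2.mul (happly.comp_aestronglyMeasurable
      (hDφc.aestronglyMeasurable.prodMk heRm.aestronglyMeasurable)))
  have hm4 : AEStronglyMeasurable (fun p : ℝ × ℝ³ => swirlEqnIntegrand F V p.1 p.2 *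
      phiCut L T p.1 p.2) μT := by
    have h1 : AEStronglyMeasurable (fun p : ℝ × ℝ³ => (Δ (F p.1)) p.2) μT := by
      rw [hμT']; exact (hP.continuousOn_laplacian.mono hsub).aestronglyMeasurable hslabm
    have h2 := hAE_DF hVm
    have h3 := hAE_DF heRm
    have h4 : Measurable fun p : ℝ × ℝ³ => 2 / cylRadius p.2 :=
      measurable_const.div (continuous_cylRadius.measurable.comp measurable_snd)
    have h : AEStronglyMeasurable (fun p : ℝ × ℝ³ => ((Δ (F p.1)) p.2 - fderiv ℝ (F p.1) p.2 (V p.1 p.2)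
        - 2 / cylRadius p.2 * fderiv ℝ (F p.1) p.2 (eR p.2)) * phiCut L T p.1 p.2) μT :=
      ((h1.sub h2).sub (h4.aestronglyMeasurable.mul h3)).mul hφc.aestronglyMeasurable
    simpa only [swirlEqnIntegrand, partialDeriv_apply] using h
  -- bounds for `∇F`, `ΔF` on the compact `[0, T] × {r ≤ 2, |z| ≤ L}`
  have hKset : IsCompact (Icc (0 : ℝ) T ×ˢ solidCylinder 2 L) := isCompact_Icc.prod (isCompact_solidCylinder 2 L)
  have hKsub : Icc (0 : ℝ) T ×ˢ solidCylinder 2 L ⊆ Iio τ' ×ˢ univ :=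
    fun p hp => ⟨lt_of_le_of_lt hp.1.2 hTτ, mem_univ _⟩
  obtain ⟨K₁, hK₁⟩ := hKset.exists_bound_of_continuousOn (hP.continuousOn_fderiv.mono hKsub)
  obtain ⟨K₂, hK₂⟩ := hKset.exists_bound_of_continuousOn (hP.continuousOn_laplacian.mono hKsub)
  set K : ℝ := max (max K₁ K₂) 0 with hK
  have hK0 : 0 ≤ K := le_max_right _ _
  have hKD : ∀ s ∈ Ioc (0 : ℝ) T, ∀ y ∈ solidCylinder 2 L, ‖fderiv ℝ (F s) y‖ ≤ K := fun s hs y hy =>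
    (hK₁ (s, y) ⟨⟨hs.1.le, hs.2⟩, hy⟩).trans ((le_max_left _ _).trans (le_max_left _ _))
  have hKΔ : ∀ s ∈ Ioc (0 : ℝ) T, ∀ y ∈ solidCylinder 2 L, |(Δ (F s)) y| ≤ K := fun s hs y hy => by
    have h := hK₂ (s, y) ⟨⟨hs.1.le, hs.2⟩, hy⟩
    rw [Real.norm_eq_abs] at h
    exact h.trans ((le_max_right _ _).trans (le_max_left _ _))
  -- bounds for the cut-off
  obtain ⟨B, hB⟩ := exists_bound_fderiv_laplacian_phiCut L T
  have hB0 : 0 ≤ B := (norm_nonneg _).trans (hB 0 0).1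
  have hCf := hP.Cf_nonneg
  have hCu := hP.Cu_nonneg
  -- the dominating function
  set Kd : ℝ := (Cf + |M|) * (2 * smoothTransitionC2Bound + B * (Cu + 1)) + 2 * Cf * B + K * (Cu + 2) + 1
    with hKd
  have hKd0 : 0 ≤ Kd := by
    have := smoothTransitionC2Bound_nonneg
    positivity
  set D : ℝ × ℝ³ → ℝ := fun p => Kd * (solidCylinder 2 L).indicator (fun y => (cylRadius y)⁻¹ + 1) p.2
    with hD
  have hDint : Integrable D μT := by
    have hg : Integrable (fun y : ℝ³ => (solidCylinder 2 L).indicator (fun y => (cylRadius y)⁻¹ + 1) y) :=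
      ((integrableOn_inv_cylRadius_solidCylinder 2 L).add (integrableOn_const (C := (1 : ℝ))
        (volume_solidCylinder_lt_top 2 L).ne)).integrable_indicator (measurableSet_solidCylinder 2 L)
    have hf : Integrable (fun _ : ℝ => Kd) (volume.restrict (Ioc (0 : ℝ) T)) :=
      integrableOn_const (C := Kd) measure_Ioc_lt_top.ne
    exact hf.mul_prod hg
  have hDval : ∀ p : ℝ × ℝ³, p.2 ∈ solidCylinder 2 L → D p = Kd * ((cylRadius p.2)⁻¹ + 1) := fun p hp => by
    simp only [hD, indicator_of_mem hp]
  have hDval' : ∀ p : ℝ × ℝ³, p.2 ∉ solidCylinder 2 L → D p = 0 := fun p hp => by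
    simp only [hD, indicator_of_notMem hp, mul_zero]
  -- elementary consequences of the bounds, for `p.1 ∈ (0, T]`
  have hFM : ∀ s ∈ Ioc (0 : ℝ) T, ∀ y, |F s y - M| ≤ Cf + |M| := fun s hs y =>
    (abs_sub _ _).trans (add_le_add (hP.abs_le s (hτ s hs) y) le_rfl)
  -- integrability of the four integrands
  have hint1 : Integrable (fun p : ℝ × ℝ³ => (F p.1 p.2 - M) * (psiCut L p.2 * deriv (zetaCut T) p.1)) μT := by
    refine hDint.mono' hm1 (hae.mono fun p hp => ?_)
    obtain ⟨hs, -⟩ := hp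
    by_cases hy : p.2 ∈ solidCylinder 2 L
    · rw [hDval p hy, Real.norm_eq_abs, abs_mul]
      have h1 := hFM p.1 hs p.2
      have h2 := abs_psiCut_mul_deriv_zetaCut_le L T p.1 p.2
      have hr : 0 ≤ (cylRadius p.2)⁻¹ := inv_nonneg.2 (cylRadius_nonneg _)
      have h3 : |F p.1 p.2 - M| * |psiCut L p.2 * deriv (zetaCut T) p.1| ≤
          (Cf + |M|) * (2 * smoothTransitionC2Bound) :=
        mul_le_mul h1 h2 (abs_nonneg _) (by positivity)
      have h4 : (Cf + |M|) * (2 * smoothTransitionC2Bound) ≤ Kd := by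
        have P1 : 0 ≤ (Cf + |M|) * (B * (Cu + 1)) := by positivity
        have P2 : 0 ≤ 2 * Cf * B := by positivity
        have P3 : 0 ≤ K * (Cu + 2) := by positivity
        rw [hKd]; nlinarith [P1, P2, P3]
      nlinarith [mul_nonneg hr (mul_nonneg (abs_nonneg (F p.1 p.2 - M))
        (abs_nonneg (psiCut L p.2 * deriv (zetaCut T) p.1)))]
    · rw [hDval' p hy, (phiCut_derivs_eq_zero_of_not_mem (T := T) (s := p.1) hy).2.2.2]
      simp
  have hint2 : Integrable (fun p : ℝ × ℝ³ => (F p.1 p.2 - M) *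
      (fderiv ℝ (phiCut L T p.1) p.2 (V p.1 p.2) + (Δ (phiCut L T p.1)) p.2)) μT := by
    refine hDint.mono' hm2 (hae.mono fun p hp => ?_)
    obtain ⟨hs, hr0⟩ := hp
    by_cases hy : p.2 ∈ solidCylinder 2 L
    · rw [hDval p hy, Real.norm_eq_abs, abs_mul]
      have hr : 0 < cylRadius p.2 := lt_of_le_of_ne (cylRadius_nonneg _) (Ne.symm hr0)
      have h1 := hFM p.1 hs p.2
      have hV : ‖V p.1 p.2‖ ≤ Cu * (cylRadius p.2)⁻¹ := by
        rw [← div_eq_mul_inv, le_div_iff₀ hr, mul_comm]; exact hP.drift_le p.1 (hτ p.1 hs) p.2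
      have h2 : |fderiv ℝ (phiCut L T p.1) p.2 (V p.1 p.2) + (Δ (phiCut L T p.1)) p.2| ≤
          B * (Cu * (cylRadius p.2)⁻¹) + B := by
        refine (abs_add_le _ _).trans (add_le_add ?_ (hB p.1 p.2).2)
        rw [← Real.norm_eq_abs]
        exact ((fderiv ℝ (phiCut L T p.1) p.2).le_opNorm _).trans (mul_le_mul (hB p.1 p.2).1 hV
          (norm_nonneg _) hB0)
      have h3 : |F p.1 p.2 - M| * |fderiv ℝ (phiCut L T p.1) p.2 (V p.1 p.2) + (Δ (phiCut L T p.1)) p.2| ≤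
          (Cf + |M|) * (B * (Cu * (cylRadius p.2)⁻¹) + B) :=
        mul_le_mul h1 h2 (abs_nonneg _) (by positivity)
      have hri : 0 ≤ (cylRadius p.2)⁻¹ := inv_nonneg.2 (cylRadius_nonneg _)
      have h4 : (Cf + |M|) * (B * (Cu * (cylRadius p.2)⁻¹) + B) ≤ Kd * ((cylRadius p.2)⁻¹ + 1) := by
        have hCS := smoothTransitionC2Bound_nonneg
        have Q1 : 0 ≤ (Cf + |M|) * B * Cu := by positivity
        have Q2 : 0 ≤ (Cf + |M|) * B * (cylRadius p.2)⁻¹ := by positivity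
        have Q3 : 0 ≤ ((Cf + |M|) * (2 * smoothTransitionC2Bound) + 2 * Cf * B + K * (Cu + 2) + 1) *
            ((cylRadius p.2)⁻¹ + 1) := by positivity
        rw [hKd]; nlinarith [Q1, Q2, Q3]
      linarith
    · rw [hDval' p hy, (phiCut_derivs_eq_zero_of_not_mem hy).2.1, (phiCut_derivs_eq_zero_of_not_mem hy).2.2.1]
      simp
  have hint3 : Integrable (fun p : ℝ × ℝ³ => 2 / cylRadius p.2 *
      (F p.1 p.2 * fderiv ℝ (phiCut L T p.1) p.2 (eR p.2))) μT := by
    refine hDint.mono' hm3 (hae.mono fun p hp => ?_)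
    obtain ⟨hs, -⟩ := hp
    by_cases hy : p.2 ∈ solidCylinder 2 L
    · rw [hDval p hy, Real.norm_eq_abs, abs_mul, abs_mul, abs_div, abs_two,
        abs_of_nonneg (cylRadius_nonneg _), div_eq_mul_inv]
      have h1 : |F p.1 p.2| ≤ Cf := hP.abs_le p.1 (hτ p.1 hs) p.2
      have h2 : |fderiv ℝ (phiCut L T p.1) p.2 (eR p.2)| ≤ B := by
        rw [← Real.norm_eq_abs]
        exact ((fderiv ℝ (phiCut L T p.1) p.2).le_opNorm _).trans
          ((mul_le_of_le_one_right (norm_nonneg _) (norm_eR_le_one _)).trans (hB p.1 p.2).1)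
      have hri : 0 ≤ (cylRadius p.2)⁻¹ := inv_nonneg.2 (cylRadius_nonneg _)
      have h3 : |F p.1 p.2| * |fderiv ℝ (phiCut L T p.1) p.2 (eR p.2)| ≤ Cf * B :=
        mul_le_mul h1 h2 (abs_nonneg _) hCf
      have h4 : 2 * (Cf * B) ≤ Kd := by
        rw [hKd]; nlinarith [smoothTransitionC2Bound_nonneg, abs_nonneg M, mul_nonneg hB0 hCu,
          mul_nonneg hK0 hCu, mul_nonneg hCf hB0]
      nlinarith [mul_nonneg hri (mul_nonneg (abs_nonneg (F p.1 p.2)) (abs_nonneg (fderiv ℝ (phiCut L T p.1) p.2 (eR p.2))))]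
    · rw [hDval' p hy, (phiCut_derivs_eq_zero_of_not_mem hy).2.1]
      simp
  have hint4 : Integrable (fun p : ℝ × ℝ³ => swirlEqnIntegrand F V p.1 p.2 * phiCut L T p.1 p.2) μT := by
    refine hDint.mono' hm4 (hae.mono fun p hp => ?_)
    obtain ⟨hs, hr0⟩ := hp
    by_cases hy : p.2 ∈ solidCylinder 2 L
    · rw [hDval p hy, Real.norm_eq_abs, abs_mul]
      have hr : 0 < cylRadius p.2 := lt_of_le_of_ne (cylRadius_nonneg _) (Ne.symm hr0)
      have hri : 0 ≤ (cylRadius p.2)⁻¹ := inv_nonneg.2 (cylRadius_nonneg _)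
      have hV : ‖V p.1 p.2‖ ≤ Cu * (cylRadius p.2)⁻¹ := by
        rw [← div_eq_mul_inv, le_div_iff₀ hr, mul_comm]; exact hP.drift_le p.1 (hτ p.1 hs) p.2
      obtain ⟨φ0, φ1⟩ := phiCut_mem_Icc L T p.1 p.2
      have hG : |swirlEqnIntegrand F V p.1 p.2| ≤ K + K * (Cu * (cylRadius p.2)⁻¹) +
          2 * (cylRadius p.2)⁻¹ * K := by
        simp only [swirlEqnIntegrand, partialDeriv_apply]
        refine (abs_sub _ _).trans (add_le_add ((abs_sub _ _).trans (add_le_add (hKΔ p.1 hs p.2 hy) ?_)) ?_)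
        · rw [← Real.norm_eq_abs]
          exact ((fderiv ℝ (F p.1) p.2).le_opNorm _).trans (mul_le_mul (hKD p.1 hs p.2 hy) hV
            (norm_nonneg _) hK0)
        · rw [abs_mul, abs_div, abs_two, abs_of_nonneg (cylRadius_nonneg _), div_eq_mul_inv,
            ← Real.norm_eq_abs]
          refine mul_le_mul_of_nonneg_left ?_ (by positivity)
          exact ((fderiv ℝ (F p.1) p.2).le_opNorm _).trans
            ((mul_le_of_le_one_right (norm_nonneg _) (norm_eR_le_one _)).trans (hKD p.1 hs p.2 hy))
      have h3 : |swirlEqnIntegrand F V p.1 p.2| * |phiCut L T p.1 p.2| ≤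
          (K + K * (Cu * (cylRadius p.2)⁻¹) + 2 * (cylRadius p.2)⁻¹ * K) * 1 := by
        refine mul_le_mul hG ?_ (abs_nonneg _) (by positivity)
        rw [abs_of_nonneg φ0]; exact φ1
      have h4 : (K + K * (Cu * (cylRadius p.2)⁻¹) + 2 * (cylRadius p.2)⁻¹ * K) * 1 ≤
          Kd * ((cylRadius p.2)⁻¹ + 1) := by
        have hCS := smoothTransitionC2Bound_nonneg
        have R1 : 0 ≤ K * Cu := by positivity
        have R2 : 0 ≤ ((Cf + |M|) * (2 * smoothTransitionC2Bound + B * (Cu + 1)) + 2 * Cf * B + 1) *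
            ((cylRadius p.2)⁻¹ + 1) := by positivity
        have R3 : 0 ≤ K * Cu * (cylRadius p.2)⁻¹ := by positivity
        rw [hKd]; nlinarith [R1, R2, R3]
      linarith
    · rw [hDval' p hy, (phiCut_derivs_eq_zero_of_not_mem hy).1]
      simp
  -- Fubini and the two identities
  refine ⟨hint1.integral_prod_left, hint2.integral_prod_left, hint3.integral_prod_left, ?_⟩
  have e1 : ∫ s in Ioc 0 T, ∫ y, (F s y - M) * (psiCut L y * deriv (zetaCut T) s) =
      ∫ y, ∫ s in Ioc 0 T, (F s y - M) * (psiCut L y * deriv (zetaCut T) s) :=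
    integral_integral_swap (f := fun s y => (F s y - M) * (psiCut L y * deriv (zetaCut T) s)) hint1
  have e2 : ∀ᵐ y ∂(volume : Measure ℝ³), ∫ s in Ioc 0 T, (F s y - M) * (psiCut L y * deriv (zetaCut T) s) =
      -∫ s in Ioc 0 T, swirlEqnIntegrand F V s y * phiCut L T s y := by
    filter_upwards [ae_cylRadius_ne_zero] with y hy
    rw [← intervalIntegral.integral_of_le hT0, ← intervalIntegral.integral_of_le hT0]
    exact hP.time_identity hT0 hTτ M hy
  have e3 : ∫ s in Ioc 0 T, ∫ y, swirlEqnIntegrand F V s y * phiCut L T s y =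
      ∫ y, ∫ s in Ioc 0 T, swirlEqnIntegrand F V s y * phiCut L T s y :=
    integral_integral_swap (f := fun s y => swirlEqnIntegrand F V s y * phiCut L T s y) hint4
  have e4 : ∫ s in Ioc 0 T, ∫ y, swirlEqnIntegrand F V s y * phiCut L T s y =
      ∫ s in Ioc 0 T, ((∫ y, (F s y - M) *
        (fderiv ℝ (phiCut L T s) y (V s y) + (Δ (phiCut L T s)) y)) +
        ∫ y, 2 / cylRadius y * (F s y * fderiv ℝ (phiCut L T s) y (eR y))) := by
    refine setIntegral_congr_fun measurableSet_Ioc fun s hs => ?_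
    have h := hP.slice_identity (hτ s hs) L T M
    simp only [swirlEqnIntegrand] at h ⊢
    rw [h]
  rw [← e4, e1, integral_congr_ae e2, integral_neg, ← e3]
  ring

end SpaceTime

/-! ### Elementary integrals for the estimates -/

section Integrals

/-- `ζ' = 0` off the open time window `(1, T)` (including the endpoints). [folklore] -/
theorem deriv_zetaCut_eq_zero_of_not_mem_Ioo {T s : ℝ} (hs : s ∉ Ioo 1 T) : deriv (zetaCut T) s = 0 := by
  rw [deriv_zetaCut]
  apply Calculus.deriv_cutoff_eq_zero_of_le
  rw [mem_Ioo, not_and_or, not_lt, not_lt] at hs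
  rcases hs with hs | hs
  · rw [le_abs]; right; linarith
  · rw [le_abs]; left; linarith

/-- `∫₀^∞ ρ · (ρ⁻¹ 1_{ρ ≤ a}) dρ = a` for `a ≥ 0`. [folklore] -/
theorem integral_Ioi_mul_indicator_inv {a : ℝ} (ha : 0 ≤ a) :
    IntegrableOn (fun ρ : ℝ => ρ * (Iic a).indicator (fun ρ => ρ⁻¹) ρ) (Ioi 0) ∧
    ∫ ρ in Ioi (0 : ℝ), ρ * (Iic a).indicator (fun ρ => ρ⁻¹) ρ = a := by
  have heq : EqOn (fun ρ : ℝ => ρ * (Iic a).indicator (fun ρ => ρ⁻¹) ρ) ((Ioc 0 a).indicator fun _ => (1 : ℝ))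
      (Ioi 0) := by
    intro ρ hρ
    by_cases h : ρ ≤ a
    · simp only [indicator_of_mem (show ρ ∈ Iic a from h), indicator_of_mem (show ρ ∈ Ioc 0 a from ⟨hρ, h⟩)]
      exact mul_inv_cancel₀ (ne_of_gt hρ)
    · simp only [indicator_of_notMem (show ρ ∉ Iic a from h),
        indicator_of_notMem (show ρ ∉ Ioc 0 a from fun h' => h h'.2), mul_zero]
  have hint : IntegrableOn ((Ioc 0 a).indicator fun _ => (1 : ℝ)) (Ioi 0) :=
    ((integrableOn_const (C := (1 : ℝ)) (measure_Ioc_lt_top (a := (0 : ℝ)) (b := a)).ne).integrable_indicator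
      measurableSet_Ioc).integrableOn
  refine ⟨hint.congr_fun heq.symm measurableSet_Ioi, ?_⟩
  rw [setIntegral_congr_fun measurableSet_Ioi heq, setIntegral_indicator measurableSet_Ioc,
    show Ioi (0 : ℝ) ∩ Ioc 0 a = Ioc 0 a from inter_eq_right.2 Ioc_subset_Ioi_self,
    setIntegral_const, Real.volume_real_Ioc_of_le ha]
  simp

/-- `∫₀^∞ ρ · 1_{ρ ≤ a} dρ = a²/2` for `a ≥ 0`. [folklore] -/
theorem integral_Ioi_mul_indicator_one {a : ℝ} (ha : 0 ≤ a) :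
    IntegrableOn (fun ρ : ℝ => ρ * (Iic a).indicator (fun _ => (1 : ℝ)) ρ) (Ioi 0) ∧
    ∫ ρ in Ioi (0 : ℝ), ρ * (Iic a).indicator (fun _ => (1 : ℝ)) ρ = a ^ 2 / 2 := by
  have heq : EqOn (fun ρ : ℝ => ρ * (Iic a).indicator (fun _ => (1 : ℝ)) ρ) ((Ioc 0 a).indicator fun ρ => ρ)
      (Ioi 0) := by
    intro ρ hρ
    by_cases h : ρ ≤ a
    · simp only [indicator_of_mem (show ρ ∈ Iic a from h), indicator_of_mem (show ρ ∈ Ioc 0 a from ⟨hρ, h⟩),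
        mul_one]
    · simp only [indicator_of_notMem (show ρ ∉ Iic a from h),
        indicator_of_notMem (show ρ ∉ Ioc 0 a from fun h' => h h'.2), mul_zero]
  have hint : IntegrableOn ((Ioc 0 a).indicator fun ρ : ℝ => ρ) (Ioi 0) :=
    (((continuous_id.integrableOn_Icc (a := (0 : ℝ)) (b := a)).mono_set Ioc_subset_Icc_self).integrable_indicator
      measurableSet_Ioc).integrableOn
  refine ⟨hint.congr_fun heq.symm measurableSet_Ioi, ?_⟩
  rw [setIntegral_congr_fun measurableSet_Ioi heq, setIntegral_indicator measurableSet_Ioc,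
    show Ioi (0 : ℝ) ∩ Ioc 0 a = Ioc 0 a from inter_eq_right.2 Ioc_subset_Ioi_self,
    ← intervalIntegral.integral_of_le ha, integral_id]
  ring

/-- **The `1/r` integral over a cylinder of radius `a` above a set `S` of heights**:
`∫ 1_{r ≤ a} r⁻¹ 1_S(x₂) dx = |S| c₂ a` (integrable). [folklore] -/
theorem integral_inv_cylRadius_indicator {a : ℝ} (ha : 0 ≤ a) {S : Set ℝ} (hS : MeasurableSet S)
    (hSfin : volume S < ⊤) :
    Integrable (fun x : ℝ³ => (Iic a).indicator (fun ρ => ρ⁻¹) (cylRadius x) * S.indicator (fun _ => (1 : ℝ)) (x 2)) ∧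
    ∫ x : ℝ³, (Iic a).indicator (fun ρ => ρ⁻¹) (cylRadius x) * S.indicator (fun _ => (1 : ℝ)) (x 2) =
      (volume.real S) * (radialConst₂ * a) := by
  obtain ⟨h1, h2⟩ := integral_Ioi_mul_indicator_inv ha
  have hg : Integrable (S.indicator fun _ : ℝ => (1 : ℝ)) :=
    (integrableOn_const (C := (1 : ℝ)) hSfin.ne).integrable_indicator hS
  obtain ⟨hi, hv⟩ := integrable_and_integral_fun_cylRadius_mul (h := (Iic a).indicator fun ρ => ρ⁻¹)
    (g := S.indicator fun _ => (1 : ℝ)) h1 hg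
  refine ⟨hi, ?_⟩
  rw [hv, h2, integral_indicator hS, setIntegral_const, smul_eq_mul, mul_one]

/-- **The volume of a cylinder of radius `a` above a set `S` of heights**:
`∫ 1_{r ≤ a} 1_S(x₂) dx = |S| c₂ a²/2` (integrable). [folklore] -/
theorem integral_cylinder_indicator {a : ℝ} (ha : 0 ≤ a) {S : Set ℝ} (hS : MeasurableSet S)
    (hSfin : volume S < ⊤) :
    Integrable (fun x : ℝ³ => (Iic a).indicator (fun _ => (1 : ℝ)) (cylRadius x) * S.indicator (fun _ => (1 : ℝ)) (x 2)) ∧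
    ∫ x : ℝ³, (Iic a).indicator (fun _ => (1 : ℝ)) (cylRadius x) * S.indicator (fun _ => (1 : ℝ)) (x 2) =
      (volume.real S) * (radialConst₂ * (a ^ 2 / 2)) := by
  obtain ⟨h1, h2⟩ := integral_Ioi_mul_indicator_one ha
  have hg : Integrable (S.indicator fun _ : ℝ => (1 : ℝ)) :=
    (integrableOn_const (C := (1 : ℝ)) hSfin.ne).integrable_indicator hS
  obtain ⟨hi, hv⟩ := integrable_and_integral_fun_cylRadius_mul (h := (Iic a).indicator fun _ => (1 : ℝ))
    (g := S.indicator fun _ => (1 : ℝ)) h1 hg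
  refine ⟨hi, ?_⟩
  rw [hv, h2, integral_indicator hS, setIntegral_const, smul_eq_mul, mul_one]

/-- **The radial cut-off integral**: `∫ (2/r) ξ'(r) η(x₂) dx = −2 c₂ ∫ η` (integrable), from
`∫₀^∞ ξ' = −1` (KNSS 2009, (5.19)–(5.20): "the last integral … is equal to `−4πM ∫∫ φ … + O(ε)`").
[cite: KochNadirashviliSereginSverak2009, proof of Thm 5.3, (5.19)–(5.20) (arXiv p. 10)] -/
theorem integral_two_div_cylRadius_mul_deriv_xiCut {η : ℝ → ℝ} (hη : Integrable η) :
    Integrable (fun x : ℝ³ => 2 / cylRadius x * deriv xiCut (cylRadius x) * η (x 2)) ∧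
    ∫ x : ℝ³, 2 / cylRadius x * deriv xiCut (cylRadius x) * η (x 2) = (∫ z, η z) * (radialConst₂ * (-2)) := by
  -- `ρ · (2/ρ) ξ'(ρ) = 2 ξ'(ρ)` on `(0, ∞)`
  have heq : EqOn (fun ρ : ℝ => ρ * (2 / ρ * deriv xiCut ρ)) (fun ρ => 2 * deriv xiCut ρ) (Ioi 0) := by
    intro ρ hρ
    have : ρ ≠ 0 := ne_of_gt hρ
    field_simp
  have hc : Continuous (deriv xiCut) := by
    rw [show deriv xiCut = fun ρ => -deriv Real.smoothTransition (2 - ρ) from funext deriv_xiCut]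
    have : Continuous (deriv Real.smoothTransition) := differentiable_deriv_smoothTransition.continuous
    fun_prop
  have hcs : HasCompactSupport (deriv xiCut) := by
    refine HasCompactSupport.intro (isCompact_Icc (a := (1 : ℝ)) (b := 2)) fun ρ hρ => ?_
    rw [mem_Icc, not_and_or, not_le, not_le] at hρ
    rcases hρ with hρ | hρ
    · exact deriv_xiCut_of_lt_one hρ
    · exact deriv_xiCut_of_two_lt hρ
  have hint' : IntegrableOn (fun ρ => 2 * deriv xiCut ρ) (Ioi 0) :=
    ((hc.integrable_of_hasCompactSupport hcs).const_mul 2).integrableOn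
  have hint : IntegrableOn (fun ρ : ℝ => ρ * (2 / ρ * deriv xiCut ρ)) (Ioi 0) :=
    hint'.congr_fun heq.symm measurableSet_Ioi
  obtain ⟨hi, hv⟩ := integrable_and_integral_fun_cylRadius_mul (h := fun ρ => 2 / ρ * deriv xiCut ρ) (g := η)
    hint hη
  refine ⟨hi.congr (Eventually.of_forall fun x => by ring), ?_⟩
  have hval : ∫ ρ in Ioi (0 : ℝ), ρ * (2 / ρ * deriv xiCut ρ) = -2 := by
    rw [setIntegral_congr_fun measurableSet_Ioi heq, integral_const_mul, integral_deriv_xiCut_Ioi]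
    norm_num
  rw [← hval, ← hv]

/-- The axial plateau cut-off `η_L = Calculus.cutoff L` is integrable, and `∫ η_L ≥ 2(L − 1)`.
[folklore] -/
theorem integrable_cutoff_and_le_integral {L : ℝ} (hL : 1 ≤ L) :
    Integrable (Calculus.cutoff L) ∧ 2 * (L - 1) ≤ ∫ z, Calculus.cutoff L z := by
  have hc : Continuous (Calculus.cutoff L) := (Calculus.contDiff_cutoff L (n := 0)).continuous
  have hcs : HasCompactSupport (Calculus.cutoff L) := by
    refine HasCompactSupport.intro (isCompact_Icc (a := -L) (b := L)) fun z hz => ?_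
    apply Calculus.cutoff_eq_zero
    rw [mem_Icc, not_and_or, not_le, not_le] at hz
    rcases hz with hz | hz
    · rw [le_abs]; right; linarith
    · rw [le_abs]; left; linarith
  have hint : Integrable (Calculus.cutoff L) := hc.integrable_of_hasCompactSupport hcs
  refine ⟨hint, ?_⟩
  have hind : Integrable ((Icc (-(L - 1)) (L - 1)).indicator fun _ : ℝ => (1 : ℝ)) :=
    (integrableOn_const (C := (1 : ℝ)) (measure_Icc_lt_top (a := -(L - 1)) (b := L - 1)).ne).integrable_indicator
      measurableSet_Icc
  have hle : ∀ z, (Icc (-(L - 1)) (L - 1)).indicator (fun _ : ℝ => (1 : ℝ)) z ≤ Calculus.cutoff L z := by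
    intro z
    by_cases hz : z ∈ Icc (-(L - 1)) (L - 1)
    · rw [indicator_of_mem hz, Calculus.cutoff_eq_one (abs_le.2 ⟨by linarith [hz.1], hz.2⟩)]
    · rw [indicator_of_notMem hz]; exact Calculus.cutoff_nonneg L z
  have h := integral_mono hind hint hle
  rw [integral_indicator measurableSet_Icc, setIntegral_const, smul_eq_mul, mul_one,
    Real.volume_real_Icc_of_le (by linarith)] at h
  linarith

/-- The real volume of a solid cylinder: `|{r ≤ a, |z| ≤ b}| = 2b · |B̄ₐ(ℝ²)|` for `b ≥ 0`.
[folklore] -/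
theorem volume_real_solidCylinder (a : ℝ) {b : ℝ} (hb : 0 ≤ b) :
    volume.real (solidCylinder a b) =
      2 * b * volume.real (closedBall (0 : EuclideanSpace ℝ (Fin 2)) a) := by
  rw [measureReal_def, volume_solidCylinder, ENNReal.toReal_mul, ENNReal.toReal_ofReal (by positivity),
    measureReal_def]

end Integrals

/-! ### The three estimates -/

section Estimates

variable {Cf Cu τ' : ℝ} {F : ℝ → ℝ³ → ℝ} {V : ℝ → ℝ³ → ℝ³}

/-- `|F − M| ≤ C_f + M` when `F ≤ M` and `|F| ≤ C_f`. [folklore] -/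
theorem abs_sub_le_of_le_of_abs_le {F M Cf : ℝ} (h1 : F ≤ M) (h2 : |F| ≤ Cf) : |F - M| ≤ Cf + M := by
  rw [_root_.abs_le] at h2 ⊢
  constructor <;> linarith [h2.1, h2.2]

/-- A nonzero value of the spatial cut-off places the point in the open cylinder
`{r < 2, |z| < L}`. [folklore] -/
theorem mem_of_psiCut_ne_zero {L : ℝ} {y : ℝ³} (h : psiCut L y ≠ 0) : cylRadius y < 2 ∧ |y 2| < L := by
  by_contra hc
  exact h (psiCut_eq_zero_of_not_mem hc)

/-- **Estimate of the time-derivative term `I`** (KNSS 2009, (5.18): `|I| ≤ C L δ² + O(ε)`, here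
with `δ = 1`): on a slice `s ∈ (0, T]`,
`|∫ (F − M) ψ ζ'(s) dy| ≤ |ζ'(s)| · 2L ((C_f + M) |B̄₁| + ε |B̄₂|)` — the unit cylinder contributes
through `|F − M| ≤ C_f + M`, the rest of the support through the plateau `|F − M| ≤ ε`. [cite: KochNadirashviliSereginSverak2009, proof of Thm 5.3, (5.18) (arXiv p. 10)] -/
theorem IsKNSSSwirlPair.estimate_I (hP : IsKNSSSwirlPair Cf Cu τ' F V) {L T M ε : ℝ} (hL : 0 ≤ L)
    (hTτ : T < τ') (hε : 0 ≤ ε) (hFM : ∀ s < τ', ∀ y, F s y ≤ M)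
    (hge : ∀ s ∈ Ioo 1 T, ∀ y ∈ annCylClosed 1 2 L, M - ε ≤ F s y) {s : ℝ} (hs : s ∈ Ioc 0 T) :
    |∫ y, (F s y - M) * (psiCut L y * deriv (zetaCut T) s)| ≤
      |deriv (zetaCut T) s| * (2 * L * ((Cf + M) * volume.real (closedBall (0 : EuclideanSpace ℝ (Fin 2)) 1) +
        ε * volume.real (closedBall (0 : EuclideanSpace ℝ (Fin 2)) 2))) := by
  have hsτ : s < τ' := lt_of_le_of_lt hs.2 hTτ
  have hCf := hP.Cf_nonneg
  have hM : 0 ≤ Cf + M := by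
    have := hFM s hsτ 0
    have h2 := (_root_.abs_le.1 (hP.abs_le s hsτ 0)).1
    linarith
  have hz0 : 0 ≤ |deriv (zetaCut T) s| := abs_nonneg _
  set bound : ℝ³ → ℝ := fun y => |deriv (zetaCut T) s| *
    ((Cf + M) * (solidCylinder 1 L).indicator (fun _ => (1 : ℝ)) y +
      ε * (solidCylinder 2 L).indicator (fun _ => (1 : ℝ)) y) with hbound
  have hi1 : Integrable ((solidCylinder 1 L).indicator fun _ : ℝ³ => (1 : ℝ)) :=
    (integrableOn_const (C := (1 : ℝ)) (volume_solidCylinder_lt_top 1 L).ne).integrable_indicator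
      (measurableSet_solidCylinder 1 L)
  have hi2 : Integrable ((solidCylinder 2 L).indicator fun _ : ℝ³ => (1 : ℝ)) :=
    (integrableOn_const (C := (1 : ℝ)) (volume_solidCylinder_lt_top 2 L).ne).integrable_indicator
      (measurableSet_solidCylinder 2 L)
  have hbint : Integrable bound := ((hi1.const_mul _).add (hi2.const_mul _)).const_mul _
  have hind1 : ∀ y, 0 ≤ (solidCylinder 1 L).indicator (fun _ : ℝ³ => (1 : ℝ)) y := fun y =>
    indicator_nonneg (fun _ _ => zero_le_one) _
  have hind2 : ∀ y, 0 ≤ (solidCylinder 2 L).indicator (fun _ : ℝ³ => (1 : ℝ)) y := fun y =>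
    indicator_nonneg (fun _ _ => zero_le_one) _
  have hle : ∀ y, ‖(F s y - M) * (psiCut L y * deriv (zetaCut T) s)‖ ≤ bound y := by
    intro y
    rw [Real.norm_eq_abs]
    have hb0 : 0 ≤ bound y := by
      simp only [hbound]
      exact mul_nonneg hz0 (add_nonneg (mul_nonneg hM (hind1 y)) (mul_nonneg hε (hind2 y)))
    by_cases hψ : psiCut L y = 0
    · rw [hψ, zero_mul, mul_zero, abs_zero]; exact hb0
    obtain ⟨hr2, hzL⟩ := mem_of_psiCut_ne_zero hψ
    have hy2 : y ∈ solidCylinder 2 L := ⟨hr2.le, hzL.le⟩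
    obtain ⟨ψ0, ψ1⟩ := psiCut_mem_Icc L y
    rw [abs_mul, abs_mul, abs_of_nonneg ψ0]
    have hψz : psiCut L y * |deriv (zetaCut T) s| ≤ |deriv (zetaCut T) s| := by
      nlinarith
    by_cases hr1 : cylRadius y ≤ 1
    · have hy1 : y ∈ solidCylinder 1 L := ⟨hr1, hzL.le⟩
      have h1 : |F s y - M| ≤ Cf + M := abs_sub_le_of_le_of_abs_le (hFM s hsτ y) (hP.abs_le s hsτ y)
      simp only [hbound, indicator_of_mem hy1, indicator_of_mem hy2, mul_one]
      have : |F s y - M| * (psiCut L y * |deriv (zetaCut T) s|) ≤ (Cf + M) * |deriv (zetaCut T) s| :=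
        mul_le_mul h1 hψz (by positivity) hM
      nlinarith
    · have hr1' : 1 < cylRadius y := lt_of_not_ge hr1
      by_cases hsI : s ∈ Ioo 1 T
      · have hyA : y ∈ annCylClosed 1 2 L := ⟨hr1'.le, hr2.le, hzL.le⟩
        have hlo := hge s hsI y hyA
        have hhi := hFM s hsτ y
        have h1 : |F s y - M| ≤ ε := by rw [_root_.abs_le]; constructor <;> linarith
        simp only [hbound, indicator_of_mem hy2, mul_one]
        have : |F s y - M| * (psiCut L y * |deriv (zetaCut T) s|) ≤ ε * |deriv (zetaCut T) s| :=
          mul_le_mul h1 hψz (by positivity) hε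
        nlinarith [mul_nonneg hz0 (mul_nonneg hM (hind1 y))]
      · rw [deriv_zetaCut_eq_zero_of_not_mem_Ioo hsI, abs_zero, mul_zero, mul_zero]
        exact hb0
  have h := norm_integral_le_of_norm_le hbint (Eventually.of_forall hle)
  rw [Real.norm_eq_abs] at h
  refine h.trans (le_of_eq ?_)
  simp only [hbound]
  rw [integral_const_mul, integral_add (hi1.const_mul _) (hi2.const_mul _), integral_const_mul,
    integral_const_mul, integral_indicator (measurableSet_solidCylinder 1 L),
    integral_indicator (measurableSet_solidCylinder 2 L), setIntegral_const, setIntegral_const,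
    smul_eq_mul, smul_eq_mul, mul_one, mul_one, volume_real_solidCylinder 1 hL,
    volume_real_solidCylinder 2 hL]
  ring

/-- **Estimate of the axis term** (KNSS 2009, p. 10, the term controlled "by `−C₁ M² T L` with
`C₁ > 0`"): for `s ∈ (0, T]`,
`∫ (2/r) F ∂ᵣφ ≤ −ζ(s) (M − ε) · 4 c₂ (L − 1)`, because `∂ᵣφ = ξ'(r) η ζ ≤ 0` is supported in
`{1 ≤ r ≤ 2, |z| ≤ L}` where `F ≥ M − ε ≥ 0`, `∫ (2/r) ξ'(r) η(z) dy = −2 c₂ ∫ η` and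
`∫ η ≥ 2 (L − 1)`. [cite: KochNadirashviliSereginSverak2009, proof of Thm 5.3 (arXiv p. 10)] -/
theorem IsKNSSSwirlPair.estimate_III (hP : IsKNSSSwirlPair Cf Cu τ' F V) {L T M ε : ℝ}
    (hL : 1 ≤ L) (hTτ : T < τ') (hεM : 0 ≤ M - ε)
    (hge : ∀ s ∈ Ioo 1 T, ∀ y ∈ annCylClosed 1 2 L, M - ε ≤ F s y) {s : ℝ} (hs : s ∈ Ioc 0 T) :
    ∫ y, 2 / cylRadius y * (F s y * fderiv ℝ (phiCut L T s) y (eR y)) ≤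
      -(zetaCut T s * ((M - ε) * (4 * radialConst₂ * (L - 1)))) := by
  have hsτ : s < τ' := lt_of_le_of_lt hs.2 hTτ
  have hF1 : ContDiff ℝ 1 (F s) := (hP.smooth s hsτ).of_le (by norm_cast)
  have hJ : Integrable fun y => 2 / cylRadius y * (F s y * fderiv ℝ (phiCut L T s) y (eR y)) :=
    integrable_two_div_cylRadius_mul_mul_fderiv_eR hF1 (contDiff_phiCut L T s)
      (hasCompactSupport_phiCut L T s) (hP.axisymmetric s hsτ) (isAxisymmetricScalar_phiCut L T s)
      (hP.axis s hsτ)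
  obtain ⟨hηi, hηge⟩ := integrable_cutoff_and_le_integral hL
  obtain ⟨hKi, hKval⟩ := integral_two_div_cylRadius_mul_deriv_xiCut hηi
  have hK : Integrable fun y : ℝ³ => zetaCut T s * (M - ε) *
      (2 / cylRadius y * deriv xiCut (cylRadius y) * Calculus.cutoff L (y 2)) := hKi.const_mul _
  obtain ⟨hζ0, hζ1⟩ := zetaCut_mem_Icc T s
  have hle : ∀ y, 2 / cylRadius y * (F s y * fderiv ℝ (phiCut L T s) y (eR y)) ≤
      zetaCut T s * (M - ε) * (2 / cylRadius y * deriv xiCut (cylRadius y) * Calculus.cutoff L (y 2)) := by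
    intro y
    rw [fderiv_phiCut_apply_eR]
    have hc : 0 ≤ 2 / cylRadius y := div_nonneg zero_le_two (cylRadius_nonneg y)
    have hξ := deriv_xiCut_nonpos (cylRadius y)
    have hη := Calculus.cutoff_nonneg L (y 2)
    have hPle : deriv xiCut (cylRadius y) * Calculus.cutoff L (y 2) * zetaCut T s ≤ 0 :=
      mul_nonpos_iff.2 (Or.inr ⟨mul_nonpos_iff.2 (Or.inr ⟨hξ, hη⟩), hζ0⟩)
    have key : (F s y - (M - ε)) *
        (deriv xiCut (cylRadius y) * Calculus.cutoff L (y 2) * zetaCut T s) ≤ 0 := by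
      by_cases h0 : deriv xiCut (cylRadius y) * Calculus.cutoff L (y 2) * zetaCut T s = 0
      · rw [h0, mul_zero]
      · obtain ⟨⟨hξ0, hη0⟩, hζne⟩ := mul_ne_zero_iff.1 h0 |>.imp_left mul_ne_zero_iff.1
        have hr1 : 1 ≤ cylRadius y := by
          by_contra h; exact hξ0 (deriv_xiCut_of_lt_one (lt_of_not_ge h))
        have hr2 : cylRadius y ≤ 2 := by
          by_contra h; exact hξ0 (deriv_xiCut_of_two_lt (lt_of_not_ge h))
        have hz : |y 2| ≤ L := by
          by_contra h; exact hη0 (Calculus.cutoff_eq_zero (le_of_lt (lt_of_not_ge h)))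
        have hsI : s ∈ Ioo 1 T := by
          by_contra h; exact hζne (zetaCut_of_not_mem_Ioo h)
        have hFge := hge s hsI y ⟨hr1, hr2, hz⟩
        exact mul_nonpos_iff.2 (Or.inl ⟨sub_nonneg.2 hFge, hPle⟩)
    have key2 : 2 / cylRadius y * ((F s y - (M - ε)) *
        (deriv xiCut (cylRadius y) * Calculus.cutoff L (y 2) * zetaCut T s)) ≤ 0 :=
      mul_nonpos_iff.2 (Or.inl ⟨hc, key⟩)
    nlinarith [key2]
  have hmono := integral_mono hJ hK hle
  refine hmono.trans ?_
  rw [integral_const_mul, hKval]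
  have hc₂ := radialConst₂_pos
  nlinarith [mul_nonneg (mul_nonneg hζ0 hεM) (mul_nonneg hc₂.le (sub_nonneg.2 hηge))]

/-- The `z`-band `S_L = [L − 1, L] ∪ [−L, −(L − 1)]` carrying the supports of `η'_L` and
`η''_L`. [folklore] -/
def etaBand (L : ℝ) : Set ℝ := Icc (L - 1) L ∪ Icc (-L) (-(L - 1))

/-- The band is measurable. [folklore] -/
theorem measurableSet_etaBand (L : ℝ) : MeasurableSet (etaBand L) :=
  measurableSet_Icc.union measurableSet_Icc

/-- The band has finite measure. [folklore] -/
theorem volume_etaBand_lt_top (L : ℝ) : volume (etaBand L) < ⊤ :=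
  measure_union_lt_top measure_Icc_lt_top measure_Icc_lt_top

/-- `|S_L| ≤ 2`. [folklore] -/
theorem volume_real_etaBand_le (L : ℝ) : volume.real (etaBand L) ≤ 2 := by
  calc volume.real (etaBand L)
      ≤ volume.real (Icc (L - 1) L) + volume.real (Icc (-L) (-(L - 1))) := measureReal_union_le _ _
    _ = 2 := by
      rw [Real.volume_real_Icc_of_le (by linarith), Real.volume_real_Icc_of_le (by linarith)]; ring

/-- `L − 1 ≤ |z| ≤ L ⇒ z ∈ S_L`. [folklore] -/
theorem mem_etaBand {L z : ℝ} (h1 : L - 1 ≤ |z|) (h2 : |z| ≤ L) : z ∈ etaBand L := by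
  rcases le_or_gt 0 z with hz | hz
  · rw [abs_of_nonneg hz] at h1 h2; exact Or.inl ⟨h1, h2⟩
  · rw [abs_of_neg hz] at h1 h2; exact Or.inr ⟨by linarith, by linarith⟩

/-- Off the band, `η'_L = η''_L = 0`. [folklore] -/
theorem derivs_etaCut_eq_zero_of_not_mem_etaBand {L z : ℝ} (h : z ∉ etaBand L) :
    deriv (Calculus.cutoff L) z = 0 ∧ deriv (deriv (Calculus.cutoff L)) z = 0 := by
  rcases lt_or_ge |z| (L - 1) with h1 | h1
  · exact ⟨Calculus.deriv_cutoff_eq_zero_of_lt h1, deriv_deriv_etaCut_of_abs_lt h1⟩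
  rcases le_or_gt |z| L with h2 | h2
  · exact absurd (mem_etaBand h1 h2) h
  · exact ⟨Calculus.deriv_cutoff_eq_zero_of_le h2.le, deriv_deriv_etaCut_of_lt_abs h2⟩

/-- **Pointwise bound near the axis** (`0 < r < 1`): there `φ = η(z) ζ(s)`, so
`|(F − M)(Dφ[V] + Δφ)| ≤ ζ (C_f + M) (2 C_S · C_u/r + 4 C_S (C_S + 1)) 1_{S_L}(z)` (KNSS 2009,
p. 10: "the integration in x₃ is only over the segments `L − 1 ≤ |x₃| ≤ L`" and `|u| ≤ C/r`,
`∫ dx'/r < ∞`). [cite: KochNadirashviliSereginSverak2009, proof of Thm 5.3 (arXiv p. 10)] -/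
theorem IsKNSSSwirlPair.near_bound (hP : IsKNSSSwirlPair Cf Cu τ' F V) {L T M s : ℝ}
    (hsτ : s < τ') (hFM : ∀ y, F s y ≤ M) {y : ℝ³} (hr0 : cylRadius y ≠ 0)
    (hr1 : cylRadius y < 1) :
    |(F s y - M) * (fderiv ℝ (phiCut L T s) y (V s y) + (Δ (phiCut L T s)) y)| ≤
      zetaCut T s * (Cf + M) *
        (2 * smoothTransitionC2Bound * Cu *
            ((Iic (1 : ℝ)).indicator (fun ρ => ρ⁻¹) (cylRadius y) *
              (etaBand L).indicator (fun _ => (1 : ℝ)) (y 2)) +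
          4 * smoothTransitionC2Bound * (smoothTransitionC2Bound + 1) *
            ((Iic (1 : ℝ)).indicator (fun _ => (1 : ℝ)) (cylRadius y) *
              (etaBand L).indicator (fun _ => (1 : ℝ)) (y 2))) := by
  rw [fderiv_phiCut_of_cylRadius_lt_one hr1, laplacian_phiCut_of_cylRadius_lt_one hr1]
  obtain ⟨hζ0, -⟩ := zetaCut_mem_Icc T s
  have hM : 0 ≤ Cf + M := by
    have h2 := (_root_.abs_le.1 (hP.abs_le s hsτ y)).1
    linarith [hFM y]
  have hrI : cylRadius y ∈ Iic (1 : ℝ) := hr1.le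
  by_cases hz : y 2 ∈ etaBand L
  · have hrpos : 0 < cylRadius y := lt_of_le_of_ne (cylRadius_nonneg y) (Ne.symm hr0)
    have h1 : |F s y - M| ≤ Cf + M := abs_sub_le_of_le_of_abs_le (hFM y) (hP.abs_le s hsτ y)
    have hv : |V s y 2| ≤ Cu * (cylRadius y)⁻¹ := by
      have hd := hP.drift_le s hsτ y
      have hn : |V s y 2| ≤ ‖V s y‖ := by
        have := PiLp.norm_apply_le (V s y) 2
        rwa [Real.norm_eq_abs] at this
      rw [← div_eq_mul_inv, le_div_iff₀ hrpos]
      nlinarith [abs_nonneg (V s y 2)]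
    have hη1 := abs_deriv_etaCut_le L (y 2)
    have hη2 := abs_deriv_deriv_etaCut_le L (y 2)
    have hC := smoothTransitionC2Bound_nonneg
    have hinner : |zetaCut T s * deriv (Calculus.cutoff L) (y 2) * V s y 2 +
        zetaCut T s * deriv (deriv (Calculus.cutoff L)) (y 2)| ≤
        zetaCut T s * (2 * smoothTransitionC2Bound * (Cu * (cylRadius y)⁻¹) +
          4 * smoothTransitionC2Bound * (smoothTransitionC2Bound + 1)) := by
      have ha : |deriv (Calculus.cutoff L) (y 2)| * |V s y 2| ≤
          2 * smoothTransitionC2Bound * (Cu * (cylRadius y)⁻¹) :=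
        mul_le_mul hη1 hv (abs_nonneg _) (by positivity)
      calc _ ≤ |zetaCut T s * deriv (Calculus.cutoff L) (y 2) * V s y 2| +
            |zetaCut T s * deriv (deriv (Calculus.cutoff L)) (y 2)| := abs_add_le _ _
        _ = zetaCut T s * (|deriv (Calculus.cutoff L) (y 2)| * |V s y 2|) +
            zetaCut T s * |deriv (deriv (Calculus.cutoff L)) (y 2)| := by
            simp only [abs_mul, abs_of_nonneg hζ0]; ring
        _ ≤ _ := by
            rw [mul_add]
            exact add_le_add (mul_le_mul_of_nonneg_left ha hζ0) (mul_le_mul_of_nonneg_left hη2 hζ0)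
    rw [abs_mul]
    calc _ ≤ (Cf + M) * (zetaCut T s * (2 * smoothTransitionC2Bound * (Cu * (cylRadius y)⁻¹) +
          4 * smoothTransitionC2Bound * (smoothTransitionC2Bound + 1))) :=
          mul_le_mul h1 hinner (abs_nonneg _) hM
      _ = _ := by simp only [indicator_of_mem hrI, indicator_of_mem hz]; ring
  · obtain ⟨h1, h2⟩ := derivs_etaCut_eq_zero_of_not_mem_etaBand hz
    simp [h1, h2, indicator_of_notMem hz]

/-- **Pointwise bound away from the axis** (`r ≥ 1`): on the support of `φ(s, ·)` and for
`s ∈ (1, T)` one has `M − ε ≤ F ≤ M`, `|u| ≤ C_u`, `‖Dφ‖, |Δφ| ≤ B`, so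
`|(F − M)(Dφ[V] + Δφ)| ≤ ε B (C_u + 1)`; for `s ∉ (1, T)`, `φ(s, ·) = 0` (KNSS 2009, p. 10:
"all the other [terms] converge to zero as `ε' → 0`"). [cite: KochNadirashviliSereginSverak2009, proof of Thm 5.3 (arXiv p. 10)] -/
theorem IsKNSSSwirlPair.far_bound (hP : IsKNSSSwirlPair Cf Cu τ' F V) {L T M ε s : ℝ}
    (hsτ : s < τ') (hε : 0 ≤ ε) (hFM : ∀ y, F s y ≤ M)
    (hge : s ∈ Ioo 1 T → ∀ y ∈ annCylClosed 1 2 L, M - ε ≤ F s y) {B : ℝ}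
    (hB : ∀ y, ‖fderiv ℝ (phiCut L T s) y‖ ≤ B ∧ |(Δ (phiCut L T s)) y| ≤ B) {y : ℝ³}
    (hr1 : 1 ≤ cylRadius y) :
    |(F s y - M) * (fderiv ℝ (phiCut L T s) y (V s y) + (Δ (phiCut L T s)) y)| ≤
      ε * (B * (Cu + 1)) * (solidCylinder 2 L).indicator (fun _ => (1 : ℝ)) y := by
  have hB0 : 0 ≤ B := (norm_nonneg _).trans (hB y).1
  have hCu := hP.Cu_nonneg
  by_cases hy2 : y ∈ solidCylinder 2 L
  · rw [indicator_of_mem hy2, mul_one]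
    by_cases hsI : s ∈ Ioo 1 T
    · have hyA : y ∈ annCylClosed 1 2 L := ⟨hr1, hy2.1, hy2.2⟩
      have hlo := hge hsI y hyA
      have h1 : |F s y - M| ≤ ε := by
        rw [_root_.abs_le]; constructor <;> linarith [hFM y]
      have hV : ‖V s y‖ ≤ Cu := by
        have := hP.drift_le s hsτ y
        nlinarith [norm_nonneg (V s y)]
      have h2 : |fderiv ℝ (phiCut L T s) y (V s y) + (Δ (phiCut L T s)) y| ≤ B * (Cu + 1) := by
        calc _ ≤ |fderiv ℝ (phiCut L T s) y (V s y)| + |(Δ (phiCut L T s)) y| := abs_add_le _ _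
          _ ≤ B * Cu + B := by
              refine add_le_add ?_ (hB y).2
              rw [← Real.norm_eq_abs]
              exact ((fderiv ℝ (phiCut L T s) y).le_opNorm _).trans
                (mul_le_mul (hB y).1 hV (norm_nonneg _) hB0)
          _ = B * (Cu + 1) := by ring
      rw [abs_mul]
      exact mul_le_mul h1 h2 (abs_nonneg _) hε
    · have hζ := zetaCut_of_not_mem_Ioo hsI
      have hD : fderiv ℝ (phiCut L T s) y (V s y) = 0 := by
        rw [fderiv_phiCut_eq, hζ, zero_smul]; rfl
      rw [hD, laplacian_phiCut_eq, hζ, zero_mul, add_zero, mul_zero, abs_zero]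
      positivity
  · obtain ⟨-, hD, hΔ, -⟩ := phiCut_derivs_eq_zero_of_not_mem (T := T) (s := s) hy2
    rw [hD, hΔ, indicator_of_notMem hy2]
    simp

/-- **Estimate of the transport term** (KNSS 2009, p. 10): for `s ∈ (0, T]`,
`|∫ (F − M)(Dφ[V] + Δφ)| ≤ ζ(s) (C_f + M) · 4 C_S c₂ (C_u + C_S + 1) + ε B (C_u + 1) · 2 L |B₂(0,2)|`:
the near-axis part is integrable thanks to `|u| ≤ C/r` and lives on the band `S_L` of
measure `≤ 2`; the far part is `O(ε)`. [cite: KochNadirashviliSereginSverak2009, proof of Thm 5.3 (arXiv p. 10)] -/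
theorem IsKNSSSwirlPair.estimate_II (hP : IsKNSSSwirlPair Cf Cu τ' F V) {L T M ε : ℝ}
    (hL : 1 ≤ L) (hTτ : T < τ') (hε : 0 ≤ ε) (hFM : ∀ s < τ', ∀ y, F s y ≤ M)
    (hge : ∀ s ∈ Ioo 1 T, ∀ y ∈ annCylClosed 1 2 L, M - ε ≤ F s y) {B : ℝ}
    (hB : ∀ s y, ‖fderiv ℝ (phiCut L T s) y‖ ≤ B ∧ |(Δ (phiCut L T s)) y| ≤ B) {s : ℝ}
    (hs : s ∈ Ioc 0 T) :
    |∫ y, (F s y - M) * (fderiv ℝ (phiCut L T s) y (V s y) + (Δ (phiCut L T s)) y)| ≤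
      zetaCut T s * ((Cf + M) * (4 * smoothTransitionC2Bound * radialConst₂ *
          (Cu + (smoothTransitionC2Bound + 1)))) +
        ε * (B * (Cu + 1) * (2 * L * volume.real (closedBall (0 : EuclideanSpace ℝ (Fin 2)) 2))) := by
  have hsτ : s < τ' := lt_of_le_of_lt hs.2 hTτ
  have hL0 : 0 ≤ L := zero_le_one.trans hL
  have hCu := hP.Cu_nonneg
  have hC := smoothTransitionC2Bound_nonneg
  have hB0 : 0 ≤ B := (norm_nonneg _).trans (hB s 0).1
  obtain ⟨hζ0, -⟩ := zetaCut_mem_Icc T s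
  have hM : 0 ≤ Cf + M := by
    have h2 := (_root_.abs_le.1 (hP.abs_le s hsτ 0)).1
    linarith [hFM s hsτ 0]
  have hS := measurableSet_etaBand L
  have hSfin := volume_etaBand_lt_top L
  have hSle := volume_real_etaBand_le L
  obtain ⟨hiA, hA⟩ := integral_inv_cylRadius_indicator zero_le_one hS hSfin
  obtain ⟨hiB, hBv⟩ := integral_cylinder_indicator zero_le_one hS hSfin
  have hiC : Integrable ((solidCylinder 2 L).indicator fun _ : ℝ³ => (1 : ℝ)) :=
    (integrableOn_const (C := (1 : ℝ)) (volume_solidCylinder_lt_top 2 L).ne).integrable_indicator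
      (measurableSet_solidCylinder 2 L)
  set near : ℝ³ → ℝ := fun y => zetaCut T s * (Cf + M) *
    (2 * smoothTransitionC2Bound * Cu *
        ((Iic (1 : ℝ)).indicator (fun ρ => ρ⁻¹) (cylRadius y) *
          (etaBand L).indicator (fun _ => (1 : ℝ)) (y 2)) +
      4 * smoothTransitionC2Bound * (smoothTransitionC2Bound + 1) *
        ((Iic (1 : ℝ)).indicator (fun _ => (1 : ℝ)) (cylRadius y) *
          (etaBand L).indicator (fun _ => (1 : ℝ)) (y 2))) with hnear
  set far : ℝ³ → ℝ := fun y => ε * (B * (Cu + 1)) *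
    (solidCylinder 2 L).indicator (fun _ => (1 : ℝ)) y with hfar
  have hnear_int : Integrable near := ((hiA.const_mul _).add (hiB.const_mul _)).const_mul _
  have hfar_int : Integrable far := hiC.const_mul _
  have hnear0 : ∀ y, 0 ≤ near y := by
    intro y
    have hi1 : 0 ≤ (Iic (1 : ℝ)).indicator (fun ρ => ρ⁻¹) (cylRadius y) :=
      indicator_apply_nonneg fun _ => inv_nonneg.2 (cylRadius_nonneg y)
    have hi2 : 0 ≤ (Iic (1 : ℝ)).indicator (fun _ => (1 : ℝ)) (cylRadius y) :=
      indicator_nonneg (fun _ _ => zero_le_one) _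
    have hi3 : 0 ≤ (etaBand L).indicator (fun _ => (1 : ℝ)) (y 2) :=
      indicator_nonneg (fun _ _ => zero_le_one) _
    simp only [hnear]
    positivity
  have hfar0 : ∀ y, 0 ≤ far y := by
    intro y
    have hi : 0 ≤ (solidCylinder 2 L).indicator (fun _ => (1 : ℝ)) y :=
      indicator_nonneg (fun _ _ => zero_le_one) _
    simp only [hfar]
    positivity
  have hle : ∀ᵐ y ∂(volume : Measure ℝ³),
      ‖(F s y - M) * (fderiv ℝ (phiCut L T s) y (V s y) + (Δ (phiCut L T s)) y)‖ ≤
        near y + far y := by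
    filter_upwards [ae_cylRadius_ne_zero] with y hy0
    rw [Real.norm_eq_abs]
    by_cases hr1 : cylRadius y < 1
    · exact (hP.near_bound hsτ (hFM s hsτ) hy0 hr1).trans (le_add_of_nonneg_right (hfar0 y))
    · exact (hP.far_bound hsτ hε (hFM s hsτ) (hge s) (hB s) (le_of_not_gt hr1)).trans
        (le_add_of_nonneg_left (hnear0 y))
  have h := norm_integral_le_of_norm_le (hnear_int.add hfar_int) hle
  rw [Real.norm_eq_abs] at h
  refine h.trans ?_
  rw [integral_add' hnear_int hfar_int]
  simp only [hnear, hfar]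
  rw [integral_const_mul, integral_add (hiA.const_mul _) (hiB.const_mul _), integral_const_mul,
    integral_const_mul, hA, hBv, integral_const_mul,
    integral_indicator (measurableSet_solidCylinder 2 L), setIntegral_const, smul_eq_mul, mul_one,
    volume_real_solidCylinder 2 hL0]
  have hc₂ := radialConst₂_pos
  have key : 0 ≤ 2 * smoothTransitionC2Bound * radialConst₂ * (Cu + (smoothTransitionC2Bound + 1)) *
      (2 - volume.real (etaBand L)) := by
    have : 0 ≤ Cu + (smoothTransitionC2Bound + 1) := by positivity
    exact mul_nonneg (by positivity) (sub_nonneg.2 hSle)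
  have key2 : zetaCut T s * (Cf + M) *
      (2 * smoothTransitionC2Bound * Cu * (volume.real (etaBand L) * (radialConst₂ * 1)) +
        4 * smoothTransitionC2Bound * (smoothTransitionC2Bound + 1) *
          (volume.real (etaBand L) * (radialConst₂ * (1 ^ 2 / 2)))) ≤
      zetaCut T s * ((Cf + M) * (4 * smoothTransitionC2Bound * radialConst₂ *
          (Cu + (smoothTransitionC2Bound + 1)))) := by
    have hζM : 0 ≤ zetaCut T s * (Cf + M) := mul_nonneg hζ0 hM
    have := mul_nonneg hζM key
    nlinarith [this]
  linarith [key2]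

/-! ### The time integrals of the cut-off -/

/-- `ζ_T` is continuous. [folklore] -/
theorem continuous_zetaCut (T : ℝ) : Continuous (zetaCut T) := (contDiff_zetaCut T (n := 0)).continuous

/-- `ζ_T'` is continuous. [folklore] -/
theorem continuous_deriv_zetaCut (T : ℝ) : Continuous (deriv (zetaCut T)) :=
  (contDiff_zetaCut T (n := 1)).continuous_deriv_one

/-- `∫₀ᵀ |ζ'| ≤ 4 C_S`: `|ζ'| ≤ 2 C_S` and `ζ'` lives on `[1, 2] ∪ [T − 1, T]`. [folklore] -/
theorem integral_abs_deriv_zetaCut_le (T : ℝ) :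
    ∫ s in Ioc 0 T, |deriv (zetaCut T) s| ≤ 4 * smoothTransitionC2Bound := by
  set U : Set ℝ := Icc 1 2 ∪ Icc (T - 1) T with hU
  have hUm : MeasurableSet U := measurableSet_Icc.union measurableSet_Icc
  have hUle : volume.real U ≤ 2 := by
    calc volume.real U ≤ volume.real (Icc (1 : ℝ) 2) + volume.real (Icc (T - 1) T) :=
          measureReal_union_le _ _
      _ = 2 := by
          rw [Real.volume_real_Icc_of_le (by norm_num), Real.volume_real_Icc_of_le (by linarith)]
          ring
  have hC := smoothTransitionC2Bound_nonneg
  have hle : ∀ s, |deriv (zetaCut T) s| ≤ 2 * smoothTransitionC2Bound * U.indicator (fun _ => (1 : ℝ)) s := by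
    intro s
    by_cases hs : s ∈ U
    · rw [indicator_of_mem hs, mul_one]; exact abs_deriv_zetaCut_le T s
    · rw [deriv_zetaCut_eq_zero hs, abs_zero, indicator_of_notMem hs, mul_zero]
  have hUfin : volume U < ⊤ := measure_union_lt_top measure_Icc_lt_top measure_Icc_lt_top
  have hgi : Integrable (fun s => 2 * smoothTransitionC2Bound * U.indicator (fun _ => (1 : ℝ)) s)
      (volume.restrict (Ioc 0 T)) :=
    (((integrableOn_const (C := (1 : ℝ)) hUfin.ne).integrable_indicator hUm).const_mul _).restrict
  calc ∫ s in Ioc 0 T, |deriv (zetaCut T) s|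
      ≤ ∫ s in Ioc 0 T, 2 * smoothTransitionC2Bound * U.indicator (fun _ => (1 : ℝ)) s :=
        integral_mono_of_nonneg (Eventually.of_forall fun s => abs_nonneg _) hgi
          (Eventually.of_forall hle)
    _ = 2 * smoothTransitionC2Bound * volume.real (U ∩ Ioc 0 T) := by
        rw [integral_const_mul, integral_indicator hUm, setIntegral_const, smul_eq_mul, mul_one,
          measureReal_restrict_apply hUm]
    _ ≤ 2 * smoothTransitionC2Bound * 2 := by
        have : volume.real (U ∩ Ioc 0 T) ≤ volume.real U :=
          measureReal_mono inter_subset_left hUfin.ne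
        nlinarith
    _ = 4 * smoothTransitionC2Bound := by ring

/-- `∫₀ᵀ ζ ≥ T − 3` for `T ≥ 3`: `ζ = 1` on `[2, T − 1]` and `ζ ≥ 0`. [folklore] -/
theorem sub_three_le_integral_zetaCut {T : ℝ} (hT : 3 ≤ T) :
    T - 3 ≤ ∫ s in Ioc 0 T, zetaCut T s := by
  have hsub : Icc 2 (T - 1) ⊆ Ioc 0 T := fun s hs => ⟨by linarith [hs.1], by linarith [hs.2]⟩
  calc T - 3 = ∫ _ in Icc 2 (T - 1), (1 : ℝ) := by
        rw [setIntegral_const, smul_eq_mul, mul_one, Real.volume_real_Icc_of_le (by linarith)]; ring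
    _ = ∫ s in Icc 2 (T - 1), zetaCut T s :=
        setIntegral_congr_fun measurableSet_Icc fun s hs => (zetaCut_of_mem_Icc hs).symm
    _ ≤ ∫ s in Ioc 0 T, zetaCut T s :=
        setIntegral_mono_set (continuous_zetaCut T).integrableOn_Ioc
          (Eventually.of_forall fun s => (zetaCut_mem_Icc T s).1) (Eventually.of_forall hsub)

/-- `∫₀ᵀ c ds = T c`. [folklore] -/
theorem integral_Ioc_const {T : ℝ} (hT : 0 ≤ T) (c : ℝ) : ∫ _ in Ioc 0 T, c = T * c := by
  rw [setIntegral_const, smul_eq_mul, Real.volume_real_Ioc_of_le hT, sub_zero]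

end Estimates

/-! ### KNSS 2009, Theorem 5.3: `sup f ≤ 0` from Lemma 2.1 -/

section Main

/-- **KNSS 2009, proof of Theorem 5.3 (arXiv p. 10), core step**: the Liouville statement
`KNSS2009_swirl_sup_nonpos` — a bounded, axisymmetric, smooth ancient solution `f` of the swirl
equation (5.10) with drift `|u| ≤ C/r`, vanishing on the axis, satisfies `f ≤ 0` — follows from
Lemma 2.1 (`KNSS2009_lemma21`). The proof is the printed one: if `M = sup f > 0`, Lemma 2.1 and
the scaling `f(λx, λ²t)`, `λ u(λx, λ²t)` give, for arbitrarily large `T = L = n` and small `ε`,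
a rescaled solution `≥ M − ε` on `{1 ≤ r ≤ 2, |z| ≤ L} × (1, T)`; testing (5.10) against
`φ = ξ(r) η_L(z) ζ_T(s)` ((5.15)–(5.20)) the axis term is `≤ −c M (L − 1)(T − 3)` while all other
terms are `O(L + T) + O(ε)`, a contradiction. (The `δ`-regularisation of (5.16)–(5.18) is
replaced by the exact identity `IsKNSSSwirlPair.spaceTime_identity`, valid because `f = 0` on the
axis makes `(2/r) f ∂ᵣφ` integrable.) [cite: KochNadirashviliSereginSverak2009, Thm 5.3 and its proof, (5.10)–(5.20) (arXiv pp. 9–10)] -/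
theorem KNSS2009_swirl_sup_nonpos_of_lemma21
    (hL21 : KNSS2009_lemma21 (EuclideanSpace ℝ (Fin 3))) : KNSS2009_swirl_sup_nonpos := by
  intro f u h1 h2 h3 h4 h5 h6 h7 h8 h9 h10 h11 t ht x
  obtain ⟨Cf, hCf⟩ := h6
  obtain ⟨Cu, hCu⟩ := h10
  obtain ⟨u', hP⟩ := IsKNSSSwirlPair.of_ae h1 h2 h3 h4 h5 hCf h7 h8 h9 hCu h11
  by_contra hxt
  have hpos : 0 < f t x := lt_of_not_ge hxt
  obtain ⟨M, hM, -, hfM, happr⟩ := hP.exists_sup ht hpos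
  have hCf0 : 0 ≤ Cf := hP.Cf_nonneg
  have hCu0 : 0 ≤ max Cu 0 := le_max_right _ _
  have hC := smoothTransitionC2Bound_nonneg
  have hc₂ := radialConst₂_pos
  have hv₁ : 0 ≤ volume.real (closedBall (0 : EuclideanSpace ℝ (Fin 2)) 1) := measureReal_nonneg
  have hv₂ : 0 ≤ volume.real (closedBall (0 : EuclideanSpace ℝ (Fin 2)) 2) := measureReal_nonneg
  -- the `L`-independent constants and the choice of `n = L = T`
  obtain ⟨a₂, ha₂⟩ : ∃ a₂ : ℝ, a₂ = (Cf + M) * (4 * smoothTransitionC2Bound * radialConst₂ *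
      (max Cu 0 + (smoothTransitionC2Bound + 1))) := ⟨_, rfl⟩
  obtain ⟨b, hb⟩ : ∃ b : ℝ, b = 32 * smoothTransitionC2Bound * (Cf + M) *
      volume.real (closedBall (0 : EuclideanSpace ℝ (Fin 2)) 1) + 1 := ⟨_, rfl⟩
  have ha₂0 : 0 ≤ a₂ := by rw [ha₂]; positivity
  have hb1 : 1 ≤ b := by
    have : 0 ≤ 32 * smoothTransitionC2Bound * (Cf + M) *
        volume.real (closedBall (0 : EuclideanSpace ℝ (Fin 2)) 1) := by positivity
    linarith only [this, hb]
  obtain ⟨m, hm⟩ : ∃ m : ℝ, m = 2 * M * radialConst₂ := ⟨_, rfl⟩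
  have hm0 : 0 < m := by rw [hm]; positivity
  obtain ⟨n, hn⟩ := exists_nat_ge (max 4 ((a₂ + b) / m + 1))
  obtain ⟨N, hN⟩ : ∃ N : ℝ, N = n := ⟨_, rfl⟩
  rw [← hN] at hn
  have hN4 : 4 ≤ N := (le_max_left _ _).trans hn
  have hNm : a₂ + b ≤ m * (N - 1) := by
    have h := (le_max_right _ _).trans hn
    have h' : (a₂ + b) / m ≤ N - 1 := by linarith only [h]
    rw [div_le_iff₀ hm0] at h'
    linarith only [h']
  have hN0 : (0 : ℝ) ≤ N := by linarith only [hN4]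
  have hN1 : (1 : ℝ) ≤ N := by linarith only [hN4]
  have hN3 : (3 : ℝ) ≤ N := by linarith only [hN4]
  obtain ⟨B, hB⟩ := exists_bound_fderiv_laplacian_phiCut N N
  have hB0 : 0 ≤ B := (norm_nonneg _).trans (hB 0 0).1
  obtain ⟨K₄, hK₄⟩ : ∃ K₄ : ℝ, K₄ = B * (max Cu 0 + 1) *
      (2 * N * volume.real (closedBall (0 : EuclideanSpace ℝ (Fin 2)) 2)) := ⟨_, rfl⟩
  have hK₄0 : 0 ≤ K₄ := by rw [hK₄]; positivity
  obtain ⟨D, hD⟩ : ∃ D : ℝ, D = 8 * smoothTransitionC2Bound * N *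
      volume.real (closedBall (0 : EuclideanSpace ℝ (Fin 2)) 2) + N * K₄ := ⟨_, rfl⟩
  have hD0 : 0 ≤ D := by rw [hD]; positivity
  obtain ⟨ε, hε⟩ : ∃ ε : ℝ, ε = min (M / 2) (1 / (2 * (D + 1))) := ⟨_, rfl⟩
  have hε0 : 0 < ε := by rw [hε]; exact lt_min (by positivity) (by positivity)
  have hεM : ε ≤ M / 2 := by rw [hε]; exact min_le_left _ _
  have hεD : ε * D ≤ 1 / 2 := by
    have hεle : ε ≤ 1 / (2 * (D + 1)) := by rw [hε]; exact min_le_right _ _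
    calc ε * D ≤ 1 / (2 * (D + 1)) * D := mul_le_mul_of_nonneg_right hεle hD0
      _ ≤ 1 / 2 := by
          rw [div_mul_eq_mul_div, one_mul, div_le_iff₀ (by positivity)]; linarith only [hD0]
  have hMε : 0 ≤ M - ε := by linarith only [hεM, hM]
  -- Lemma 2.1 step: the rescaled solution is `≥ M − ε` on `K × (1, N)`
  obtain ⟨lam, hlam, tstar, htstar, zbar, hge⟩ :=
    hP.exists_rescale_ge hL21 hM hfM happr (L := N) (T := N) (ε := ε) hN1 hε0
  have hresc := hP.rescale hlam tstar zbar N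
  set F : ℝ → ℝ³ → ℝ := stPull (lam ^ 2) lam (tstar - lam ^ 2 * N) (zbar • eZ) f with hFdef
  set V : ℝ → ℝ³ → ℝ³ := lam • stPull (lam ^ 2) lam (tstar - lam ^ 2 * N) (zbar • eZ) u'
    with hVdef
  set τ' : ℝ := N + (0 - tstar) / lam ^ 2 with hτ'def
  have hτ' : N < τ' := by
    have : 0 < (0 - tstar) / lam ^ 2 := div_pos (by linarith only [htstar]) (by positivity)
    rw [hτ'def]; linarith only [this]
  have hFM : ∀ s < τ', ∀ y, F s y ≤ M := by
    intro s hs y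
    rw [hFdef, stPull_rescale_apply]
    apply hfM
    have h1 : s - N < (0 - tstar) / lam ^ 2 := by rw [hτ'def] at hs; linarith only [hs]
    have h2 := (lt_div_iff₀ (by positivity : (0 : ℝ) < lam ^ 2)).1 h1
    linarith only [h2]
  -- the space–time identity and the three estimates, integrated in time
  obtain ⟨hi1, hi2, hi3, hsum⟩ := hresc.spaceTime_identity (L := N) hN0 hτ' M
  obtain ⟨K₁, hK₁⟩ : ∃ K₁ : ℝ, K₁ = 2 * N * ((Cf + M) *
      volume.real (closedBall (0 : EuclideanSpace ℝ (Fin 2)) 1) +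
        ε * volume.real (closedBall (0 : EuclideanSpace ℝ (Fin 2)) 2)) := ⟨_, rfl⟩
  obtain ⟨K₃, hK₃⟩ : ∃ K₃ : ℝ, K₃ = (M - ε) * (4 * radialConst₂ * (N - 1)) := ⟨_, rfl⟩
  have hK₁0 : 0 ≤ K₁ := by rw [hK₁]; positivity
  have hA1 : (∫ s in Ioc 0 N, ∫ y, (F s y - M) * (psiCut N y * deriv (zetaCut N) s)) ≤
      ∫ s in Ioc 0 N, |deriv (zetaCut N) s| * K₁ := by
    refine integral_mono_ae hi1 ?_ ?_
    · exact ((continuous_deriv_zetaCut N).abs.mul continuous_const).integrableOn_Ioc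
    · refine (ae_restrict_iff' measurableSet_Ioc).2 (Eventually.of_forall fun s hs => ?_)
      rw [hK₁]
      exact (le_abs_self _).trans (hresc.estimate_I hN0 hτ' hε0.le hFM hge hs)
  have hA23 : (∫ s in Ioc 0 N, ((∫ y, (F s y - M) *
        (fderiv ℝ (phiCut N N s) y (V s y) + (Δ (phiCut N N s)) y)) +
        ∫ y, 2 / cylRadius y * (F s y * fderiv ℝ (phiCut N N s) y (eR y)))) ≤
      ∫ s in Ioc 0 N, ((a₂ - K₃) * zetaCut N s + ε * K₄) := by
    refine integral_mono_ae (hi2.fun_add hi3) ?_ ?_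
    · exact ((continuous_const.mul (continuous_zetaCut N)).add continuous_const).integrableOn_Ioc
    · refine (ae_restrict_iff' measurableSet_Ioc).2 (Eventually.of_forall fun s hs => ?_)
      have e2 := hresc.estimate_II hN1 hτ' hε0.le hFM hge hB hs
      have e3 := hresc.estimate_III hN1 hτ' hMε hge hs
      rw [← ha₂, ← hK₄] at e2
      rw [← hK₃] at e3
      have e2' := le_abs_self (∫ y, (F s y - M) *
        (fderiv ℝ (phiCut N N s) y (V s y) + (Δ (phiCut N N s)) y))
      linarith only [e2, e3, e2']
  have hIζ' := integral_abs_deriv_zetaCut_le N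
  have hIζ := sub_three_le_integral_zetaCut hN3
  have hR1 : (∫ s in Ioc 0 N, |deriv (zetaCut N) s| * K₁) =
      (∫ s in Ioc 0 N, |deriv (zetaCut N) s|) * K₁ := integral_mul_const K₁ _
  have hR2 : (∫ s in Ioc 0 N, ((a₂ - K₃) * zetaCut N s + ε * K₄)) =
      (a₂ - K₃) * (∫ s in Ioc 0 N, zetaCut N s) + N * (ε * K₄) := by
    rw [integral_add, integral_const_mul, integral_Ioc_const hN0]
    · exact (continuous_const.mul (continuous_zetaCut N)).integrableOn_Ioc
    · exact continuous_const.integrableOn_Ioc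
  -- the sign of `a₂ − K₃` and the elementary inequalities
  have hK₃ge : a₂ + b ≤ K₃ := by
    have h1 : m * (N - 1) ≤ K₃ := by
      rw [hK₃, hm]
      linarith only [mul_nonneg (mul_nonneg hc₂.le (show (0 : ℝ) ≤ N - 1 by linarith only [hN4]))
        (show (0 : ℝ) ≤ M - 2 * ε by linarith only [hεM])]
    linarith only [h1, hNm]
  have hfin1 : (∫ s in Ioc 0 N, |deriv (zetaCut N) s|) * K₁ ≤ 4 * smoothTransitionC2Bound * K₁ :=
    mul_le_mul_of_nonneg_right hIζ' hK₁0
  have hCK₁ : smoothTransitionC2Bound * K₁ = smoothTransitionC2Bound * (2 * N * ((Cf + M) *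
      volume.real (closedBall (0 : EuclideanSpace ℝ (Fin 2)) 1) +
        ε * volume.real (closedBall (0 : EuclideanSpace ℝ (Fin 2)) 2))) := by rw [hK₁]
  have hfin2 : (a₂ - K₃) * (∫ s in Ioc 0 N, zetaCut N s) ≤ (a₂ - K₃) * (N - 3) :=
    mul_le_mul_of_nonpos_left hIζ (by linarith only [hK₃ge, hb1])
  have hfin3 : (a₂ - K₃) * (N - 3) ≤ -b * (N - 3) :=
    mul_le_mul_of_nonneg_right (by linarith only [hK₃ge]) (by linarith only [hN4])
  have hbN : b * (N - 3) = (32 * smoothTransitionC2Bound * (Cf + M) *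
      volume.real (closedBall (0 : EuclideanSpace ℝ (Fin 2)) 1) + 1) * (N - 3) := by rw [hb]
  have hfin4 : 8 * smoothTransitionC2Bound * (Cf + M) *
      volume.real (closedBall (0 : EuclideanSpace ℝ (Fin 2)) 1) * N ≤
      32 * smoothTransitionC2Bound * (Cf + M) *
        volume.real (closedBall (0 : EuclideanSpace ℝ (Fin 2)) 1) * (N - 3) := by
    have hP0 : 0 ≤ smoothTransitionC2Bound * (Cf + M) *
        volume.real (closedBall (0 : EuclideanSpace ℝ (Fin 2)) 1) := by positivity
    linarith only [mul_nonneg hP0 (show (0 : ℝ) ≤ 24 * N - 96 by linarith only [hN4])]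
  -- `0 = ∫A₁ + ∫(A₂ + A₃) ≤ ε D − 1 ≤ −1/2`
  have key : (0 : ℝ) ≤ 8 * smoothTransitionC2Bound * N * ε *
      volume.real (closedBall (0 : EuclideanSpace ℝ (Fin 2)) 2) + N * (ε * K₄) - 1 := by
    linarith only [hsum, hA1, hR1, hfin1, hCK₁, hA23, hR2, hfin2, hfin3, hbN, hfin4, hN4]
  have hεD' : ε * D = 8 * smoothTransitionC2Bound * N * ε *
      volume.real (closedBall (0 : EuclideanSpace ℝ (Fin 2)) 2) + N * (ε * K₄) := by
    rw [hD]; ring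
  linarith only [hεD, hεD', key]

/-- **KNSS 2009, Theorem 5.3 from the printed inputs**: the Liouville theorem for bounded weak
ancient axisymmetric solutions with `|u| ≤ C/r` follows from Lemma 2.1 (`KNSS2009_lemma21`),
the §4 regularity / swirl-equation fact (`KNSS2009_regularity_axisymmetric_swirl`) and
Theorem 5.2 (`KNSS2009_liouville_axisymmetric_no_swirl`). [cite: KochNadirashviliSereginSverak2009, Thm 5.3 (arXiv p. 10)] -/
theorem KNSS2009_liouville_bound_C_over_r_of_lemma21
    (hL21 : KNSS2009_lemma21 (EuclideanSpace ℝ (Fin 3)))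
    (hreg : KNSS2009_regularity_axisymmetric_swirl)
    (h52 : KNSS2009_liouville_axisymmetric_no_swirl) : KNSS2009_liouville_bound_C_over_r :=
  KNSS2009_liouville_bound_C_over_r_of_facts hreg (KNSS2009_swirl_sup_nonpos_of_lemma21 hL21) h52

end Main

end Literature.Analysis.FluidPDE

end
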